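import Mathlib
import Literature.NumberTheory.NumberFields.PureCubicClassNumberModThree
import Literature.NumberTheory.NumberFields.TameAbsorption
import Literature.NumberTheory.NumberFields.UnramifiedViaInertia
import Literature.NumberTheory.NumberFields.InertiaGeneratesGalois
import Literature.NumberTheory.NumberFields.UnramifiedCubicBaseChange
import Literature.NumberTheory.NumberFields.UnramifiedCyclicOddDegreeArtinMap
import Literature.Barriers.HodgeConjecture.ConjugateVarietiesSerreProofs
import Literature.NumberTheory.NumberFields.KummerCubeRootUnramified
import HarnessLib

/-!
# Honda's criterion `3 ∣ h(ℚ(∛(pq)))`, `pq ≡ ±1 (mod 9)` — proofs (bottom-up installments)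

Sibling proof file of `PureCubicClassNumberModThree.lean` (the named fact
`Literature.NumberTheory.NumberFields.Honda1971_three_dvd_classNumber_twoPrimes`,
[AouissiMayerIsmailiTalbiAzizi2020, Thm. 2.3 with eq. (2.1)]; originally T. Honda, *Pure cubic
fields whose class numbers are multiples of three*, J. Number Theory 3 (1971) 7–12).  Theorem-only
file (no definition, no named fact, D-0026).

The printed proof (loc. cit., p. 6) runs: `3 ∤ #C_{k,3}^{(σ)} ⟺ 3 ∤ h_k ⟺ 3 ∤ h_L`, with
`L = ℚ(∛(pq))`, `k = L(ζ₃)`, `σ` a generator of `Gal(k/ℚ(ζ₃))`, through Chevalley's ambiguous class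
number formula for `k/ℚ(ζ₃)` (conductor `f = pq`, eq. (2.1): species 2 since `pq ≡ ±1 (mod 9)`)
and the class number relation `h_k = (Q/3) h_L²`.  This file holds the elementary layer every
version of the argument needs, all PROVED:

* `Honda1971.not_twoFive_iff` — the residue bookkeeping: for `pq ≡ ±1 (mod 9)`,
  `¬(p, q ≡ 2,5 (mod 9))` iff `p ≡ 1 (mod 3)` or `q ≡ 1 (mod 3)` or `p ≡ q ≡ 8 (mod 9)`
  (the three cases "a prime divisor of `f` splits in `ℚ(ζ₃)`" / "`u = 2`" of Thm. 2.2–2.3);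
* `Honda1971.irreducible_X_pow_three_sub_C` — `X³ − pq` is irreducible over `ℚ` (`p ≠ q` primes);
* `Honda1971.minpoly_eq`, `Honda1971.adjoin_eq_top` — a cubic number field `K ∋ α`, `α³ = pq`,
  is `ℚ(α)` with `minpoly α = X³ − pq` (so all such `K` are `≅ ℚ(∛(pq))`);
* `Honda1971.ramificationIdx_eq_three` — `p` is totally ramified in such a `K`:
  every prime `v ∋ p` of `𝓞 K` has `e(v | p) = 3` (from `v(α)³ = v(p) v(q) = v(p)` and `e ≤ 3`).

Installment 2 — **genus theory** (the rows `s̃ ≥ 1` of loc. cit. eq. (2.3): a prime divisor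
`ℓ ≡ 1 (mod 3)` of the conductor gives `3 ∣ h_L`; Honda 1971, §1), proved on the tree's class field
theory for unramified cyclic extensions of odd degree
(`dvd_classNumber_of_isUnramifiedIn_of_odd_prime_card`, Cox Cor. 5.24):

* `Honda1971.exists_intermediateField_finrank_eq_three`,
  `Honda1971.not_dvd_discr_of_intermediateField_cyclotomic` — the cyclic cubic subfield `C` of
  `ℚ(ζ_p)` for `p ≡ 1 (mod 3)`, unramified away from `p`;
* `Honda1971.isCyclic_inertia_of_not_dvd_card` (tame inertia is cyclic),
  `Honda1971.pow_six_eq_one_of_isSplittingField_mul` (the Galois closure of `K·C` has exponent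
  dividing `6`), `Honda1971.isUnramifiedIn_compositum` (inertia-group bookkeeping: `KC/K` is
  unramified at every finite prime — Abhyankar's lemma at `p`, where `e(p, K) = 3`);
* `Honda1971.three_dvd_classNumber_of_prime_mod_three`,
  `Honda1971.three_dvd_classNumber_of_mod_three_eq_one` — **`p ≡ 1 (mod 3)` (or `q ≡ 1 (mod 3)`)
  implies `3 ∣ h(K)`** for every cubic `K ∋ ∛(pq)`.

Installment 3: `Honda1971.dvd_classNumber_of_dvd_classNumber_of_not_dvd_finrank` — `p ∣ h(K)`,
`p ∤ [L:K]` ⟹ `p ∣ h(L)` (relative norm; the easy half `3 ∣ h_K ⟹ 3 ∣ h_{K(ζ₃)}` of Honda's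
`3 ∣ h_K ⟺ 3 ∣ h_k`).

Installment 4 (first bricks of the remaining cases, which run through `k = K(ζ₃)`):
`Honda1971.span_pair_pow_three_eq_span` — `(p, α)³ = (p)` for `α³ = pq` (the ideal cube root of
`(p)`, input of the Kummer/genus step `k(∛p)/k` unramified for `p ≡ ±1 (mod 9)`);
`Honda1971.pow_three_ne_of_orderOf_eq_three`, `Honda1971.orderOf_mk_eq_three` — `ζ₃` is not a cube
in `𝔽_{p^f}` (`f ≤ 2`) for `p ≡ 2, 5 (mod 9)` and has order `3` modulo every prime not above `3`
(the local obstruction to `ζ₃ ∈ N_{k/ℚ(ζ₃)}(k^×)` in the case `3 ∤ h`).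

Installment 5: `Honda1971.exists_fixed_ne_one_pow_eq_one` — a `p`-group acting by automorphisms
on a finite abelian group of order divisible by `p` fixes a non-trivial element of order `p`
(the step `3 ∣ h_k ⟹ 3 ∣ #C_{k,3}^{(σ)}` of loc. cit. Thm. 2.3).

Installment 6: functoriality of Mathlib's `ClassGroup.mulEquiv` (`Honda1971.classGroup_mulEquiv_mk`,
`…_refl`, `…_trans`), whence the Galois group acts on the class group through
`σ ↦ ClassGroup.mulEquiv (RingOfIntegers.mapRingEquiv σ)`, and
`Honda1971.exists_fixed_class_of_dvd_classNumber` — for `Gal(L/K)` a `p`-group and `p ∣ h(L)` there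
is a `Gal(L/K)`-fixed (ambiguous) class of order `p`.

`Honda1971.norm_ne_of_inertia_eq_top` (with `smul_mem_pow_iff_of_inertia`,
`intValuation_smul_of_inertia`, `valuation_smul_of_inertia`, `valuation_eq_one_of_norm_eq_unit`):
for `L/F` Galois cubic, `ζ ∈ 𝓞 F` a primitive cube root of unity and `P ∣ p` a prime of `L` with
residue field of order `p` or `p²`, `p ≡ 2, 5 (mod 9)`, at which `Gal(L/F)` is inertia, `ζ` is not
a norm from `L` — the local half of case (A) (`3 ∤ h`).

`Honda1971.norm_ne_of_cubeRoot_of_mod_nine` (with `three_dvd_ramificationIdx`,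
`ramificationIdx_mul_inertiaDeg_le_finrank`, `card_quot_eq_of_cubeRoot`,
`smul_sub_mem_of_three_dvd_ramificationIdx`): for `L/F` Galois cubic over a quadratic field
`F ∋ ζ₃` with `∛(pq) ∈ L`, `p ≡ 2, 5 (mod 9)`: the prime of `L` above `p` is totally ramified in
`L/F` with residue field `𝔽_p` or `𝔽_{p²}`, whence `ζ₃ ∉ N_{L/F}(L^×)` — the complete local half
of case (A).

Installment 7: `Honda1971.exists_ambient` — the Galois number field `M = ℚ(∛(pq), ζ₃)` with
its cubic subfield `K₁ = ℚ(∛(pq))` (`[M:K₁] = 2`, every cubic field containing `∛(pq)` is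
`≅ K₁`) and quadratic subfield `F = ℚ(ζ₃)` (`[M:F] = 3`, `ζ₃ ∈ 𝓞 F`); and
`Honda1971.caseA_reduction` — for `p ≡ 2, 5 (mod 9)` and `3 ∣ h(K)`: `Gal(M/F)` fixes a class of
order `3` in `Cl(M)` while `ζ₃ ∉ N_{M/F}(M^×)`, i.e. case (A) is reduced to the count of ambiguous
classes.

Installment 8 (inputs of the ambiguous class number formula for `M/F`):
`isCyclotomicExtension_three` (a quadratic `F ∋ ζ₃` is
`ℚ(ζ₃)`), `classNumber_eq_one_of_sq_add_self_add_one` (`h(F) = 1`, Mathlib `three_pid`),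
`isTotallyComplex_of_sq_add_self_add_one`, `ramificationIdx_eq_three_of_three_dvd` (`e(𝔓|𝔭) = 3`
above `p, q`), `exists_norm_eq_unit_iff` (a unit of `𝓞 F` is a norm from `M` iff it is `±1`, so
`(E_F : E_F ∩ N M^×) = 3`).

Installment 9 (ramification of `M/F`): `isUnramifiedAt_of_one_add_lambda_cubed_of_three_mem` —
Hecke's criterion at `λ ∣ 3` in local form (`u ≡ 1 (mod λ³)`, `E = H(∛u)` ⟹ every `𝔔 ∋ 3`
unramified; the wild half of `KummerCubeRootUnramified` without the global hypothesis `(u) = 𝔞³`);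
`isUnramifiedAt_of_cube_eq` (`𝔇(F(∛a)/F) ∋ 3 ∛a²`: primes `∌ 3a` are unramified);
`adjoin_eq_top_of_finrank`, `adjoin_neg_eq`; and `isUnramifiedAt_of_natCast_notMem`: for
`pq ≡ ±1 (mod 9)` every prime `𝔔 ∌ pq` of `M` is unramified over `F` (the conductor of `M/F` is
`pq`, loc. cit. eq. (2.1)).

Still missing for `Honda1971_three_dvd_classNumber_twoPrimes_holds`: the case `p ≡ q ≡ 8 (mod 9)`
of `3 ∣ h_K` and the converse `p, q ≡ 2,5 (mod 9) ⟹ 3 ∤ h_K`, both resting on Chevalley's ambiguous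
class number formula for `K(ζ₃)/ℚ(ζ₃)` (not yet in the tree).

## References

* S. Aouissi, D. C. Mayer, M. C. Ismaili, M. Talbi, A. Azizi, *3-rank of ambiguous class groups of
  cubic Kummer extensions*, Period. Math. Hungar. 81 (2020), Thm. 2.3, eq. (2.1) (arXiv:1804.00767,
  pp. 5–6). [AouissiMayerIsmailiTalbiAzizi2020]
* T. Honda, *Pure cubic fields whose class numbers are multiples of three*, J. Number Theory 3
  (1971) 7–12, Theorem. [Honda1971]
* D. A. Cox, *Primes of the form x² + ny²*, 2nd ed. (2013), §5.C Cor. 5.24. [Cox2013]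
* D. A. Marcus, *Number Fields*, 2nd ed. (2018), Ch. 4, Ex. 21–23 (tame inertia). [Marcus2018]
-/

noncomputable section

open Polynomial NumberField IsDedekindDomain
open scoped IntermediateField nonZeroDivisors

namespace Literature.NumberTheory.NumberFields

namespace Honda1971

/-! ### Residues modulo `9` -/

/-- **Case split of Honda's criterion for `f = pq`.**  If `pq ≡ ±1 (mod 9)` then
`¬ (p ≡ 2,5 ∧ q ≡ 2,5 (mod 9))` iff `p ≡ 1 (mod 3)` or `q ≡ 1 (mod 3)` or `p ≡ q ≡ 8 (mod 9)`
(a finite check on residues modulo `9`; note `3 ∤ pq`). [folklore] -/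
theorem not_twoFive_iff {p q : ℕ} (hpq : (p * q) % 9 = 1 ∨ (p * q) % 9 = 8) :
    ¬ ((p % 9 = 2 ∨ p % 9 = 5) ∧ (q % 9 = 2 ∨ q % 9 = 5)) ↔
      (p % 3 = 1 ∨ q % 3 = 1 ∨ (p % 9 = 8 ∧ q % 9 = 8)) := by
  have key : ∀ a ∈ Finset.range 9, ∀ b ∈ Finset.range 9, ((a * b) % 9 = 1 ∨ (a * b) % 9 = 8) →
      (¬ ((a = 2 ∨ a = 5) ∧ (b = 2 ∨ b = 5)) ↔ (a % 3 = 1 ∨ b % 3 = 1 ∨ (a = 8 ∧ b = 8))) := by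
    decide
  have hp3 : p % 3 = (p % 9) % 3 := (Nat.mod_mod_of_dvd p (by norm_num : 3 ∣ 9)).symm
  have hq3 : q % 3 = (q % 9) % 3 := (Nat.mod_mod_of_dvd q (by norm_num : 3 ∣ 9)).symm
  have hmul : (p * q) % 9 = ((p % 9) * (q % 9)) % 9 := Nat.mul_mod p q 9
  rw [hp3, hq3]
  exact key (p % 9) (Finset.mem_range.mpr (Nat.mod_lt _ (by norm_num))) (q % 9)
    (Finset.mem_range.mpr (Nat.mod_lt _ (by norm_num))) (hmul ▸ hpq)

/-- Under `pq ≡ ±1 (mod 9)` neither prime is `3`. [folklore] -/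
theorem ne_three_of_mul_mod_nine {p q : ℕ} (hpq : (p * q) % 9 = 1 ∨ (p * q) % 9 = 8) :
    p ≠ 3 ∧ q ≠ 3 := by
  constructor
  · rintro rfl
    omega
  · rintro rfl
    omega

/-! ### The polynomial `X³ − pq` and the field `ℚ(∛(pq))` -/

/-- `pq` (distinct primes) is not a rational cube: `3 v_p(b) = v_p(pq) = 1` is impossible.
[folklore] -/
theorem pow_three_ne {p q : ℕ} (hp : p.Prime) (hq : q.Prime) (hpq : p ≠ q) (b : ℚ) :
    b ^ 3 ≠ ((p * q : ℕ) : ℚ) := by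
  intro hb
  haveI : Fact p.Prime := ⟨hp⟩
  haveI : Fact q.Prime := ⟨hq⟩
  have hb0 : b ≠ 0 := by
    rintro rfl
    have : ((p * q : ℕ) : ℚ) = 0 := by rw [← hb]; norm_num
    exact (Nat.cast_ne_zero.mpr (Nat.mul_ne_zero hp.ne_zero hq.ne_zero)) this
  have h1 : padicValRat p (b ^ 3) = (3 : ℕ) * padicValRat p b := padicValRat.pow b
  have h2 : padicValRat p (((p * q : ℕ) : ℚ)) = 1 := by
    rw [padicValRat.of_nat, padicValNat.mul hp.ne_zero hq.ne_zero, padicValNat_self,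
      padicValNat_primes hpq]
    norm_num
  rw [hb, h2] at h1
  omega

/-- **`X³ − pq` is irreducible over `ℚ`** for distinct primes `p, q`. [folklore] -/
theorem irreducible_X_pow_three_sub_C {p q : ℕ} (hp : p.Prime) (hq : q.Prime) (hpq : p ≠ q) :
    Irreducible (X ^ 3 - C ((p * q : ℕ) : ℚ) : ℚ[X]) :=
  X_pow_sub_C_irreducible_of_prime Nat.prime_three (pow_three_ne hp hq hpq)

variable {K : Type*} [Field K] [NumberField K]

/-- **The minimal polynomial of a cube root of `pq` is `X³ − pq`.** [folklore] -/
theorem minpoly_eq {p q : ℕ} (hp : p.Prime) (hq : q.Prime) (hpq : p ≠ q) {α : K}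
    (hα : α ^ 3 = ((p * q : ℕ) : K)) : minpoly ℚ α = X ^ 3 - C ((p * q : ℕ) : ℚ) := by
  refine (minpoly.eq_of_irreducible_of_monic (irreducible_X_pow_three_sub_C hp hq hpq) ?_
    (monic_X_pow_sub_C _ (by norm_num))).symm
  simp [hα]

/-- **A cubic number field containing a cube root `α` of `pq` is `ℚ(α)`.** [folklore] -/
theorem adjoin_eq_top {p q : ℕ} (hp : p.Prime) (hq : q.Prime) (hpq : p ≠ q)
    (h3 : Module.finrank ℚ K = 3) {α : K} (hα : α ^ 3 = ((p * q : ℕ) : K)) :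
    IntermediateField.adjoin ℚ {α} = ⊤ := by
  rw [Field.primitive_element_iff_minpoly_natDegree_eq, minpoly_eq hp hq hpq hα, h3,
    natDegree_X_pow_sub_C]

/-! ### `p` is totally ramified in `K` -/

omit [NumberField K] in
/-- A cube root of the integer `pq` is an algebraic integer. [folklore] -/
theorem exists_ringOfIntegers_coe_eq {p q : ℕ} {α : K} (hα : α ^ 3 = ((p * q : ℕ) : K)) :
    ∃ θ : 𝓞 K, (θ : K) = α := by
  have hint : IsIntegral ℤ α := by
    refine ⟨X ^ 3 - C ((p * q : ℕ) : ℤ), monic_X_pow_sub_C _ (by norm_num), ?_⟩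
    simp [hα]
  exact ⟨⟨α, hint⟩, rfl⟩

/-- The prime `pℤ` lies below every prime of `𝓞 K` containing `p`. [folklore] -/
theorem under_int_eq_span {p : ℕ} (hp : p.Prime) (v : HeightOneSpectrum (𝓞 K))
    (hv : (p : 𝓞 K) ∈ v.asIdeal) : v.asIdeal.under ℤ = Ideal.span {(p : ℤ)} := by
  haveI := v.isMaximal
  haveI hmax : (Ideal.span {(p : ℤ)}).IsMaximal :=
    Ideal.IsPrime.isMaximal
      ((Ideal.span_singleton_prime (by exact_mod_cast hp.ne_zero)).mpr
        (Nat.prime_iff_prime_int.mp hp)) (by simpa using hp.ne_zero)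
  refine (hmax.eq_of_le (Ideal.IsMaximal.under ℤ v.asIdeal).ne_top ?_).symm
  rw [Ideal.span_singleton_le_iff_mem, Ideal.under_def, Ideal.mem_comap, map_natCast]
  exact hv

omit [NumberField K] in
/-- Distinct primes stay coprime in `𝓞 K`: a proper ideal containing `p` misses `q`. [folklore] -/
theorem natCast_notMem_of_mem {p q : ℕ} (hp : p.Prime) (hq : q.Prime) (hpq : p ≠ q)
    (v : HeightOneSpectrum (𝓞 K)) (hv : (p : 𝓞 K) ∈ v.asIdeal) : (q : 𝓞 K) ∉ v.asIdeal := by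
  intro hqv
  have hcop : IsCoprime (p : 𝓞 K) (q : 𝓞 K) := by
    have h' : IsCoprime (p : ℤ) (q : ℤ) :=
      Nat.isCoprime_iff_coprime.mpr ((Nat.coprime_primes hp hq).mpr hpq)
    simpa using h'.map (algebraMap ℤ (𝓞 K))
  obtain ⟨a, b, hab⟩ := hcop
  have h1 : (1 : 𝓞 K) ∈ v.asIdeal := by
    rw [← hab]
    exact v.asIdeal.add_mem (v.asIdeal.mul_mem_left a hv) (v.asIdeal.mul_mem_left b hqv)
  exact v.isPrime.ne_top ((Ideal.eq_top_iff_one _).mpr h1)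

/-- **`p` is totally ramified in a cubic field containing `∛(pq)`**: every prime `v ∋ p` of `𝓞 K`
has ramification index `e(v | p) = 3`.  Proof: with `θ = ∛(pq) ∈ 𝓞 K`, `v(θ)³ = v(p) v(q) = v(p)`
forces `3 ∣ e(v|p)`, and `e(v|p) ≤ [K : ℚ] = 3`. [folklore] -/
theorem ramificationIdx_eq_three {p q : ℕ} (hp : p.Prime) (hq : q.Prime) (hpq : p ≠ q)
    (h3 : Module.finrank ℚ K = 3) {α : K} (hα : α ^ 3 = ((p * q : ℕ) : K))
    (v : HeightOneSpectrum (𝓞 K)) (hv : (p : 𝓞 K) ∈ v.asIdeal) :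
    v.asIdeal.ramificationIdx ℤ = 3 := by
  classical
  haveI := v.isMaximal
  obtain ⟨θ, hθ⟩ := exists_ringOfIntegers_coe_eq hα
  have hθ3 : θ ^ 3 = (p : 𝓞 K) * (q : 𝓞 K) := by
    apply RingOfIntegers.coe_injective
    have h := hα
    rw [← hθ] at h
    push_cast at h ⊢
    exact_mod_cast h
  -- `v ∣ pℤ`
  set P : Ideal ℤ := Ideal.span {(p : ℤ)} with hPdef
  have hunder : v.asIdeal.under ℤ = P := under_int_eq_span hp v hv
  haveI : v.asIdeal.LiesOver P := ⟨hunder.symm⟩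
  haveI : P.IsMaximal := hunder ▸ Ideal.IsMaximal.under ℤ v.asIdeal
  have hP0 : P ≠ ⊥ := by
    rw [hPdef, Ne, Ideal.span_singleton_eq_bot]
    exact_mod_cast hp.ne_zero
  have hPmap : P.map (algebraMap ℤ (𝓞 K)) = Ideal.span {(p : 𝓞 K)} := by
    rw [hPdef, Ideal.map_span, Set.image_singleton, map_natCast]
  have hp0 : (p : 𝓞 K) ≠ 0 := by exact_mod_cast hp.ne_zero
  have hq0 : (q : 𝓞 K) ≠ 0 := by exact_mod_cast hq.ne_zero
  have hPmap0 : P.map (algebraMap ℤ (𝓞 K)) ≠ ⊥ := by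
    rw [hPmap, Ne, Ideal.span_singleton_eq_bot]
    exact hp0
  -- `e(v|p)` is the multiplicity of `v` in `(p)`, i.e. `v(p) = exp(-e)`
  have he : v.asIdeal.ramificationIdx ℤ = multiplicity v.asIdeal (Ideal.span {(p : 𝓞 K)}) := by
    rw [Ideal.IsDedekindDomain.ramificationIdx_eq_multiplicity P v.asIdeal hPmap0, hPmap]
  have hvp : v.intValuation (p : 𝓞 K) = WithZero.exp (-(v.asIdeal.ramificationIdx ℤ : ℤ)) := by
    rw [he]
    exact v.intValuation_eq_exp_neg_multiplicity hp0
  -- `v(q) = 1`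
  have hvq : v.intValuation (q : 𝓞 K) = 1 :=
    HeightOneSpectrum.intValuation_eq_one_iff.mpr (natCast_notMem_of_mem hp hq hpq v hv)
  -- `v(θ) = exp(-m)`
  have hθ0 : θ ≠ 0 := by
    rintro rfl
    rw [zero_pow (by norm_num)] at hθ3
    exact mul_ne_zero hp0 hq0 hθ3.symm
  have hvθ := v.intValuation_eq_exp_neg_multiplicity hθ0
  set m : ℕ := multiplicity v.asIdeal (Ideal.span {θ}) with hmdef
  -- `v(θ)³ = v(p) v(q)`
  have hval : WithZero.exp (-(m : ℤ)) ^ 3 = WithZero.exp (-(v.asIdeal.ramificationIdx ℤ : ℤ)) := by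
    rw [← hvθ, ← map_pow, hθ3, map_mul, hvp, hvq, mul_one]
  rw [← WithZero.exp_nsmul, WithZero.exp_inj] at hval
  have h3dvd : (v.asIdeal.ramificationIdx ℤ : ℤ) = 3 * m := by
    rw [nsmul_eq_mul] at hval
    push_cast at hval
    linarith
  -- `0 < e ≤ 3`
  have hle : v.asIdeal.ramificationIdx ℤ ≤ 3 := by
    have h := Ideal.ramificationIdx_le_finrank (S := 𝓞 K) ℚ K v.asIdeal (p := P)
    rwa [Ideal.ramificationIdx'_eq_ramificationIdx P v.asIdeal hP0, h3] at h
  have hpos : 0 < v.asIdeal.ramificationIdx ℤ := Ideal.ramificationIdx_pos v.asIdeal ℤ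
  omega

/-- Consequently the prime above `p` has residue degree `1` and is unique: the primes of `𝓞 K`
containing `p` form a singleton. [folklore] -/
theorem eq_of_mem_of_mem {p q : ℕ} (hp : p.Prime) (hq : q.Prime) (hpq : p ≠ q)
    (h3 : Module.finrank ℚ K = 3) {α : K} (hα : α ^ 3 = ((p * q : ℕ) : K))
    (v w : HeightOneSpectrum (𝓞 K)) (hv : (p : 𝓞 K) ∈ v.asIdeal) (hw : (p : 𝓞 K) ∈ w.asIdeal) :
    v = w := by
  classical
  by_contra hne
  haveI := v.isMaximal
  haveI := w.isMaximal
  set P : Ideal ℤ := Ideal.span {(p : ℤ)} with hPdef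
  have hunderv : v.asIdeal.under ℤ = P := under_int_eq_span hp v hv
  have hunderw : w.asIdeal.under ℤ = P := under_int_eq_span hp w hw
  haveI : v.asIdeal.LiesOver P := ⟨hunderv.symm⟩
  haveI : w.asIdeal.LiesOver P := ⟨hunderw.symm⟩
  haveI : P.IsMaximal := hunderv ▸ Ideal.IsMaximal.under ℤ v.asIdeal
  have hP0 : P ≠ ⊥ := by
    rw [hPdef, Ne, Ideal.span_singleton_eq_bot]
    exact_mod_cast hp.ne_zero
  have hev := ramificationIdx_eq_three hp hq hpq h3 hα v hv
  have hew := ramificationIdx_eq_three hp hq hpq h3 hα w hw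
  -- the fundamental identity `∑ e f = 3` over the primes above `p`
  have hsum := Ideal.sum_ramification_inertia (R := ℤ) (S := 𝓞 K) ℚ K hP0
  rw [h3] at hsum
  have hvmem : v.asIdeal ∈ IsDedekindDomain.primesOverFinset P (𝓞 K) :=
    (IsDedekindDomain.mem_primesOverFinset_iff hP0 _).mpr ⟨v.isPrime, inferInstance⟩
  have hwmem : w.asIdeal ∈ IsDedekindDomain.primesOverFinset P (𝓞 K) :=
    (IsDedekindDomain.mem_primesOverFinset_iff hP0 _).mpr ⟨w.isPrime, inferInstance⟩
  have hne' : v.asIdeal ≠ w.asIdeal := fun h => hne (HeightOneSpectrum.ext h)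
  have h2 : P.ramificationIdx' v.asIdeal * P.inertiaDeg' v.asIdeal +
      P.ramificationIdx' w.asIdeal * P.inertiaDeg' w.asIdeal ≤ 3 := by
    rw [← hsum]
    calc P.ramificationIdx' v.asIdeal * P.inertiaDeg' v.asIdeal +
          P.ramificationIdx' w.asIdeal * P.inertiaDeg' w.asIdeal
        = ∑ x ∈ ({v.asIdeal, w.asIdeal} : Finset (Ideal (𝓞 K))),
            P.ramificationIdx' x * P.inertiaDeg' x :=
          (Finset.sum_pair (f := fun x => P.ramificationIdx' x * P.inertiaDeg' x) hne').symm
      _ ≤ _ := Finset.sum_le_sum_of_subset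
            (Finset.insert_subset_iff.mpr ⟨hvmem, Finset.singleton_subset_iff.mpr hwmem⟩)
  rw [Ideal.ramificationIdx'_eq_ramificationIdx P v.asIdeal hP0,
    Ideal.ramificationIdx'_eq_ramificationIdx P w.asIdeal hP0, hev, hew] at h2
  have hfv : 0 < P.inertiaDeg' v.asIdeal := Nat.pos_of_ne_zero (Ideal.inertiaDeg'_ne_zero P _)
  have hfw : 0 < P.inertiaDeg' w.asIdeal := Nat.pos_of_ne_zero (Ideal.inertiaDeg'_ne_zero P _)
  omega

/-! ### Unramified compositum: the inertia-group bookkeeping -/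

/-- **Unramified compositum (numerical Abhyankar lemma for a cubic genus field).**  Let `M/ℚ` be a
Galois number field, `K₁, C₁ ⊆ M` subfields and `E₂ = K₁C₁`, viewed over `K₁`, Galois of degree
`3` over `K₁`; let `p` be a prime such that (a) `C₁` is unramified at the primes of `M` not above
`p`, and (b) at every prime `𝔔 ∋ p` of `M`, `e(𝔔 | p) < 3 · e(𝔔 ∩ K₁ | p)`.  Then every finite
prime of `K₁` is unramified in `E₂`.  (Inertia groups in `G = Gal(M/ℚ)`: off `p`,
`I(𝔔) ≤ Gal(M/C₁)` gives `I(𝔔) ∩ Gal(M/K₁) ≤ Gal(M/E₂)`, i.e. `e(𝔔|K₁) ≤ e(𝔔|E₂)`; above `p`,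
`e(𝔔|K₁) = e(𝔔|p)/e(𝔔 ∩ K₁|p) < 3`; in both cases `e(𝔓|K₁) = e(𝔔|K₁)/e(𝔔|E₂)` is `< 3` and
divides `[E₂ : K₁] = 3`.) [folklore] -/
theorem isUnramifiedIn_compositum {M : Type*} [Field M] [NumberField M] [IsGalois ℚ M]
    (K₁ C₁ : IntermediateField ℚ M) (E₂ : IntermediateField K₁ M)
    (hE : E₂.restrictScalars ℚ = K₁ ⊔ C₁) [IsGalois K₁ E₂] (h3 : Module.finrank K₁ E₂ = 3)
    {p : ℕ}
    (ha : ∀ (Q : Ideal (𝓞 M)) [Q.IsMaximal], (p : 𝓞 M) ∉ Q →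
      Algebra.IsUnramifiedAt ℤ (Q.under (𝓞 C₁)))
    (hb : ∀ (Q : Ideal (𝓞 M)) [Q.IsMaximal], (p : 𝓞 M) ∈ Q →
      Q.ramificationIdx ℤ < 3 * (Q.under (𝓞 K₁)).ramificationIdx ℤ)
    (v : HeightOneSpectrum (𝓞 K₁)) : Algebra.IsUnramifiedIn (𝓞 E₂) v.asIdeal := by
  classical
  refine (Algebra.isUnramifiedIn_iff_forall_of_isDedekindDomain' v.ne_bot).mpr ?_
  intro P hPmax hPover
  haveI := hPmax
  haveI := hPover
  -- a prime `𝔔` of `M` above `P`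
  obtain ⟨Q, hQmax, hQover⟩ :=
    Ideal.exists_maximal_ideal_liesOver_of_isIntegral (S := 𝓞 M) P
  haveI := hQmax
  haveI := hQover
  -- `e(𝔔|K₁) = e(P|K₁) · e(𝔔|E₂)`, `e(P|K₁) ∣ 3`
  haveI : Q.LiesOver (P.under (𝓞 K₁)) := Ideal.LiesOver.trans Q P (P.under (𝓞 K₁))
  have htower : Q.ramificationIdx (𝓞 K₁) =
      P.ramificationIdx (𝓞 K₁) * Q.ramificationIdx (𝓞 E₂) :=
    Ideal.ramificationIdx_tower (R := 𝓞 K₁) P Q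
  have hdvd3 : P.ramificationIdx (𝓞 K₁) ∣ 3 := h3 ▸ ramificationIdx_dvd_finrank P
  have hposE : 0 < Q.ramificationIdx (𝓞 E₂) := Ideal.ramificationIdx_pos _ _
  have hposP : 0 < P.ramificationIdx (𝓞 K₁) := Ideal.ramificationIdx_pos _ _
  -- we show `e(P|K₁) = 1`
  suffices hP1 : P.ramificationIdx (𝓞 K₁) = 1 from Ideal.ramificationIdx_eq_one_iff.mp hP1
  by_cases hpQ : (p : 𝓞 M) ∈ Q
  · -- above `p`: `e(𝔔|ℤ) = e(𝔔 ∩ K₁|ℤ) · e(𝔔|K₁) < 3 e(𝔔 ∩ K₁|ℤ)`, so `e(𝔔|K₁) < 3`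
    have hb' := hb Q hpQ
    have ht : Q.ramificationIdx ℤ =
        (Q.under (𝓞 K₁)).ramificationIdx ℤ * Q.ramificationIdx (𝓞 K₁) :=
      Ideal.ramificationIdx_tower (R := ℤ) (Q.under (𝓞 K₁)) Q
    rw [ht, htower] at hb'
    haveI : (Q.under (𝓞 K₁)).IsMaximal := Ideal.IsMaximal.under _ Q
    have hpos : 0 < (Q.under (𝓞 K₁)).ramificationIdx ℤ := Ideal.ramificationIdx_pos _ _
    have hlt : P.ramificationIdx (𝓞 K₁) * Q.ramificationIdx (𝓞 E₂) < 3 := by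
      by_contra h
      push Not at h
      have := Nat.mul_le_mul_left ((Q.under (𝓞 K₁)).ramificationIdx ℤ) h
      omega
    have hP3 : P.ramificationIdx (𝓞 K₁) < 3 := by nlinarith
    rcases (Nat.dvd_prime Nat.prime_three).mp hdvd3 with h | h
    · exact h
    · omega
  · -- off `p`: `I(𝔔) ≤ Gal(M/C₁)`, so `I(𝔔) ∩ Gal(M/K₁) ≤ Gal(M/E₂)`
    have hI : Q.inertia (M ≃ₐ[ℚ] M) ≤ C₁.fixingSubgroup :=
      (isUnramifiedAt_under_iff_inertia_le M C₁ Q).mp (ha Q hpQ)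
    -- `e(𝔔|F) = #(I(𝔔) ⊓ Gal(M/F))`
    have hcard : ∀ F : IntermediateField ℚ M,
        Nat.card (Q.inertia (M ≃ₐ[ℚ] M) ⊓ F.fixingSubgroup : Subgroup (M ≃ₐ[ℚ] M)) =
          Q.ramificationIdx (𝓞 F) := by
      intro F
      haveI : IsGaloisGroup F.fixingSubgroup F M :=
        IsGaloisGroup.intermediateField (M ≃ₐ[ℚ] M) ℚ M F
      rw [← card_inertia_eq_ramificationIdx M F.fixingSubgroup F Q,
        card_inertia_eq_card_inf_range M Q F.fixingSubgroup.subtype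
          F.fixingSubgroup.subtype_injective (fun _ _ => rfl), Subgroup.range_subtype]
    have hle : (Q.inertia (M ≃ₐ[ℚ] M) ⊓ K₁.fixingSubgroup : Subgroup (M ≃ₐ[ℚ] M)) ≤
        Q.inertia (M ≃ₐ[ℚ] M) ⊓ (E₂.restrictScalars ℚ).fixingSubgroup := by
      rw [hE, IntermediateField.fixingSubgroup_sup]
      intro x hx
      exact ⟨hx.1, hx.2, hI hx.1⟩
    have hle' := Subgroup.card_le_of_le hle
    rw [hcard K₁, hcard (E₂.restrictScalars ℚ)] at hle'
    -- `e(𝔔 | E₂.restrictScalars ℚ) = e(𝔔 | E₂)` (same field)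
    have hsame : Q.ramificationIdx (𝓞 (E₂.restrictScalars ℚ)) = Q.ramificationIdx (𝓞 E₂) := rfl
    rw [hsame, htower] at hle'
    -- `e(P|K₁) · e ≤ e` forces `e(P|K₁) = 1`
    have hle1 : P.ramificationIdx (𝓞 K₁) ≤ 1 := by
      by_contra h
      push Not at h
      nlinarith
    omega

/-! ### The cyclic cubic field of conductor `p ≡ 1 (mod 3)` -/

/-- **For a prime `p ≡ 1 (mod 3)`, a `p`-th cyclotomic field has a Galois cubic subfield** (the
fixed field of the cubes in the cyclic group `Gal(ℚ(ζ_p)/ℚ) ≅ (ℤ/p)ˣ` of order `p − 1`).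
[folklore] -/
theorem exists_intermediateField_finrank_eq_three {p : ℕ} [hp : Fact p.Prime] (hp1 : p % 3 = 1)
    (L : Type*) [Field L] [NumberField L] [IsCyclotomicExtension {p} ℚ L] :
    ∃ C : IntermediateField ℚ L, IsGalois ℚ C ∧ Module.finrank ℚ C = 3 := by
  classical
  haveI : IsGalois ℚ L := IsCyclotomicExtension.isGalois {p} ℚ L
  let e : Gal(L/ℚ) ≃* (ZMod p)ˣ := IsCyclotomicExtension.Rat.galEquivZMod p L
  have hcomm : ∀ a b : Gal(L/ℚ), a * b = b * a := fun a b =>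
    e.injective (by rw [map_mul, map_mul, mul_comm])
  let H : Subgroup Gal(L/ℚ) :=
    ((powMonoidHom 3 : (ZMod p)ˣ →* (ZMod p)ˣ).range).comap e.toMonoidHom
  haveI hHn : H.Normal := ⟨fun n hn g => by rwa [hcomm g n, mul_inv_cancel_right]⟩
  have hidx : H.index = 3 := by
    have hsurj : Function.Surjective e.toMonoidHom := e.surjective
    dsimp only [H]
    rw [Subgroup.index_comap_of_surjective _ hsurj, IsCyclic.index_powMonoidHom_range,
      Nat.card_eq_fintype_card, ZMod.card_units p]
    have h3 : 3 ∣ p - 1 := by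
      have := hp.out.two_le
      omega
    exact Nat.gcd_eq_right h3
  refine ⟨IntermediateField.fixedField H, IsGalois.of_fixedField_normal_subgroup H, ?_⟩
  have htower := Module.finrank_mul_finrank ℚ (IntermediateField.fixedField H) L
  rw [IntermediateField.finrank_fixedField_eq_card, ← IsGalois.card_aut_eq_finrank ℚ L,
    ← Subgroup.card_mul_index H, hidx] at htower
  have hH0 : Nat.card H ≠ 0 := Nat.card_pos.ne'
  rw [mul_comm] at htower
  exact Nat.eq_of_mul_eq_mul_left (Nat.pos_of_ne_zero hH0) htower

/-- **Subfields of `ℚ(ζ_p)` are unramified away from `p`**: no prime `ℓ ≠ p` divides their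
discriminant (`d ∣ d(ℚ(ζ_p)) = ± p^{p−2}`). [folklore] -/
theorem not_dvd_discr_of_intermediateField_cyclotomic {p : ℕ} [hp : Fact p.Prime]
    (L : Type*) [Field L] [NumberField L] [IsCyclotomicExtension {p} ℚ L]
    (C : IntermediateField ℚ L) {ℓ : ℕ} (hℓ : ℓ.Prime) (hℓp : ℓ ≠ p) :
    ¬ (ℓ : ℤ) ∣ NumberField.discr C := by
  intro h
  have h2 : NumberField.discr C ∣ NumberField.discr L := NumberField.discr_dvd_discr C L
  have h3 := IsCyclotomicExtension.Rat.discr_prime p L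
  have h4 : (ℓ : ℤ) ∣ (p : ℤ) ^ (p - 2) := by
    have := h.trans h2
    rw [h3] at this
    exact (Int.isUnit_iff.mpr (Or.inr rfl) |>.pow _ |>.dvd_mul_left).mp this
  have h5 : ℓ ∣ p ^ (p - 2) := by exact_mod_cast h4
  exact hℓp ((Nat.prime_dvd_prime_iff_eq hℓ hp.out).mp (hℓ.dvd_of_dvd_pow h5))

/-! ### Tame inertia and automorphisms of order dividing `6` -/

/-- **Tame inertia is cyclic.**  In a Galois number field `M/ℚ`, if `p ∤ #Gal(M/ℚ)` then the
inertia group of every maximal ideal `𝔔 ∋ p` is cyclic: `G₁(𝔔)` is a `p`-group (tree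
`Ideal.isPGroup_ramificationSubgroup_one`), hence trivial, and `G₀/G₁ ↪ κ(𝔔)ˣ` (tree
`exists_monoidHom_ramificationSubgroup_zero_units`, Marcus Ch. 4 Ex. 21). [folklore] -/
theorem isCyclic_inertia_of_not_dvd_card {M : Type*} [Field M] [NumberField M] [IsGalois ℚ M]
    {p : ℕ} (hp : p.Prime) (hpG : ¬ p ∣ Nat.card (M ≃ₐ[ℚ] M)) (Q : Ideal (𝓞 M)) [Q.IsMaximal]
    (hQ : (p : 𝓞 M) ∈ Q) : IsCyclic (Q.inertia (M ≃ₐ[ℚ] M)) := by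
  classical
  haveI hGal : IsGaloisGroup (M ≃ₐ[ℚ] M) ℤ (𝓞 M) := inferInstance
  haveI : FaithfulSMul (M ≃ₐ[ℚ] M) (𝓞 M) := hGal.faithful
  have hQne : Q ≠ ⊥ := Ideal.IsMaximal.ne_bot_of_isIntegral_int Q
  have hQtop : Q ≠ ⊤ := Ideal.IsMaximal.ne_top inferInstance
  haveI : Finite (𝓞 M ⧸ Q) := Ideal.finiteQuotientOfFreeOfNeBot Q hQne
  haveI : Fact p.Prime := ⟨hp⟩
  -- `G₁ = ⊥`
  have hG1 : Q.ramificationSubgroup (M ≃ₐ[ℚ] M) 1 = ⊥ := by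
    have hP := Q.isPGroup_ramificationSubgroup_one (M ≃ₐ[ℚ] M) hQtop hQ
    rcases hP.card_eq_or_dvd with h1 | hdvd
    · exact Subgroup.eq_bot_of_card_eq _ h1
    · exact absurd (hdvd.trans (Subgroup.card_subgroup_dvd_card _)) hpG
  -- `θ₀ : G₀ ↪ κ(𝔔)ˣ`
  obtain ⟨π, hπ, hπ2⟩ := Ideal.exists_mem_pow_notMem_pow_succ Q hQne hQtop 1
  rw [pow_one] at hπ
  obtain ⟨θ, -, hker⟩ :=
    Literature.NumberTheory.GaloisRepresentations.exists_monoidHom_ramificationSubgroup_zero_units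
      (G := M ≃ₐ[ℚ] M) hQne hπ hπ2
  have hinj : Function.Injective θ := by
    rw [← MonoidHom.ker_eq_bot_iff, hker, hG1, Subgroup.bot_subgroupOf]
  letI : Field (𝓞 M ⧸ Q) := Ideal.Quotient.field Q
  haveI : IsCyclic θ.range := inferInstance
  have hcyc : IsCyclic (Q.ramificationSubgroup (M ≃ₐ[ℚ] M) 0) :=
    isCyclic_of_surjective (MonoidHom.ofInjective hinj).symm.toMonoidHom
      (MonoidHom.ofInjective hinj).symm.surjective
  rwa [Ideal.ramificationSubgroup_zero] at hcyc

/-- **Automorphisms of the splitting field of a product of two cubics have order dividing `6`**: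
such an automorphism permutes the (at most three) roots of each factor, and a permutation of at
most three letters has order dividing `3! = 6`. [folklore] -/
theorem pow_six_eq_one_of_isSplittingField_mul {F M : Type*} [Field F] [Field M] [Algebra F M]
    {f g : F[X]} (hf : f.natDegree ≤ 3) (hg : g.natDegree ≤ 3) (hf0 : f ≠ 0) (hg0 : g ≠ 0)
    [IsSplittingField F M (f * g)] (σ : M ≃ₐ[F] M) : σ ^ 6 = 1 := by
  classical
  -- `σ^6` fixes every root of a polynomial of degree `≤ 3`
  have key : ∀ h : F[X], h.natDegree ≤ 3 → ∀ x ∈ h.rootSet M, (σ ^ 6) x = x := by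
    intro h hh x hx
    let ρ := MulAction.toPermHom (M ≃ₐ[F] M) (h.rootSet M)
    have hcard : Fintype.card (h.rootSet M) ≤ 3 := by
      rw [← Nat.card_eq_fintype_card, Nat.card_coe_set_eq]
      exact (h.ncard_rootSet_le M).trans hh
    have h6 : (ρ σ) ^ 6 = 1 := by
      have hdvd : orderOf (ρ σ) ∣ Nat.factorial 3 := by
        refine orderOf_dvd_card.trans ?_
        rw [Fintype.card_perm]
        exact Nat.factorial_dvd_factorial hcard
      exact orderOf_dvd_iff_pow_eq_one.mp hdvd
    have h6' : ρ (σ ^ 6) = 1 := by rw [map_pow]; exact h6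
    have h7 := congrArg (fun τ : Equiv.Perm (h.rootSet M) => ((τ ⟨x, hx⟩ : h.rootSet M) : M)) h6'
    simpa only [ρ, MulAction.toPermHom_apply, MulAction.toPerm_apply, Equiv.Perm.one_apply,
      rootSet.coe_smul, AlgEquiv.smul_def] using h7
  -- the roots of `f * g` generate `M`
  have hgen := IsSplittingField.adjoin_rootSet M (f * g)
  have hcoe : ((σ ^ 6 : M ≃ₐ[F] M) : M →ₐ[F] M) = ((1 : M ≃ₐ[F] M) : M →ₐ[F] M) := by
    refine AlgHom.ext_of_adjoin_eq_top hgen fun x hx => ?_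
    have hx' : x ∈ f.rootSet M ∨ x ∈ g.rootSet M := by
      rw [mem_rootSet_of_ne (mul_ne_zero hf0 hg0), map_mul, mul_eq_zero] at hx
      rcases hx with h | h
      · exact Or.inl ((mem_rootSet_of_ne hf0).mpr h)
      · exact Or.inr ((mem_rootSet_of_ne hg0).mpr h)
    change (σ ^ 6) x = (1 : M ≃ₐ[F] M) x
    rw [AlgEquiv.one_apply]
    rcases hx' with h | h
    · exact key f hf x h
    · exact key g hg x h
  exact AlgEquiv.coe_toAlgHom_injective hcoe


/-! ### Genus theory: a prime factor `p ≡ 1 (mod 3)` of the radicand forces `3 ∣ h` -/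

/-- The class number is invariant under ring isomorphism of number fields. [folklore] -/
theorem classNumber_eq_of_ringEquiv {K K' : Type*} [Field K] [NumberField K] [Field K']
    [NumberField K'] (e : K ≃+* K') : classNumber K = classNumber K' := by
  unfold classNumber
  exact Fintype.card_congr (ClassGroup.mulEquiv (RingOfIntegers.mapRingEquiv e)).toEquiv

/-- **Genus theory for `ℚ(∛(pq))` (Honda 1971, §1; the row `s̃ ≥ 1` of
[AouissiMayerIsmailiTalbiAzizi2020, (2.3)]): if `p ≡ 1 (mod 3)` then `3 ∣ h(K)` for every cubic
number field `K ∋ ∛(pq)`.**  Proof: the cubic subfield `C` of `ℚ(ζ_p)` gives the cyclic cubic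
extension `KC/K`, unramified at every finite prime (off `p` because `C` is unramified there; above
`p` because `p` is tame in the Galois closure `N = ℚ(∛(pq), ζ₃, C)`, whose inertia groups are
cyclic of order dividing `6`, while `e(p, K) = 3`); the tree's Artin map for unramified cyclic
extensions of odd degree (`dvd_classNumber_of_isUnramifiedIn_of_odd_prime_card`, Cox Cor. 5.24)
then gives `3 ∣ h_K`. [cite: AouissiMayerIsmailiTalbiAzizi2020, §2.3 eq. (2.3) and Thm. 2.3] -/
theorem three_dvd_classNumber_of_prime_mod_three {p q : ℕ} (hp : p.Prime) (hq : q.Prime)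
    (hpq : p ≠ q) (hp1 : p % 3 = 1) (K : Type) [Field K] [NumberField K]
    (h3 : Module.finrank ℚ K = 3) {α : K} (hα : α ^ 3 = ((p * q : ℕ) : K)) :
    3 ∣ classNumber K := by
  classical
  haveI : Fact p.Prime := ⟨hp⟩
  haveI : NeZero p := ⟨hp.ne_zero⟩
  haveI : IsCyclotomicExtension {p} ℚ (CyclotomicField p ℚ) :=
    CyclotomicField.isCyclotomicExtension p ℚ
  -- (1) the cyclic cubic field `C ⊆ ℚ(ζ_p)`, a generator `η`, `g = minpoly η`
  obtain ⟨C, hCgal, hC3⟩ := exists_intermediateField_finrank_eq_three hp1 (CyclotomicField p ℚ)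
  haveI := hCgal
  obtain ⟨η, hη⟩ := Field.exists_primitive_element ℚ C
  have hηint : IsIntegral ℚ η := Algebra.IsIntegral.isIntegral η
  obtain ⟨g, hgdef⟩ : ∃ g : ℚ[X], g = minpoly ℚ η := ⟨_, rfl⟩
  have hgmonic : g.Monic := hgdef ▸ minpoly.monic hηint
  have hg0 : g ≠ 0 := hgmonic.ne_zero
  have hgdeg : g.natDegree = 3 := by
    rw [hgdef, ← IntermediateField.adjoin.finrank hηint, hη, IntermediateField.finrank_top', hC3]
  have hgsplitC : (g.map (algebraMap ℚ C)).Splits := hgdef ▸ Normal.splits inferInstance η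
  have hgη : aeval η g = 0 := hgdef ▸ minpoly.aeval ℚ η
  -- (2) the ambient Galois number field `M`, a splitting field of `(X³ - pq) · g`
  obtain ⟨f₁, hf₁def⟩ : ∃ f₁ : ℚ[X], f₁ = X ^ 3 - Polynomial.C ((p * q : ℕ) : ℚ) := ⟨_, rfl⟩
  have hf₁monic : f₁.Monic := hf₁def ▸ monic_X_pow_sub_C _ (by norm_num)
  have hf₁0 : f₁ ≠ 0 := hf₁monic.ne_zero
  have hf₁deg : f₁.natDegree = 3 := by rw [hf₁def, natDegree_X_pow_sub_C]
  obtain ⟨M, _instF, _instNF, _instG, _instS⟩ :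
      ∃ (M : Type) (_ : Field M) (_ : NumberField M) (_ : IsGalois ℚ M),
        IsSplittingField ℚ M (f₁ * g) := by
    -- the splitting field, with its `ℚ`-algebra structure identified with the canonical one
    obtain ⟨instA, hS, hFD, hNo⟩ : ∃ inst : Algebra ℚ (f₁ * g).SplittingField,
        @IsSplittingField ℚ (f₁ * g).SplittingField _ _ inst (f₁ * g) ∧
        @FiniteDimensional ℚ (f₁ * g).SplittingField _ _ inst.toModule ∧
        @Normal ℚ (f₁ * g).SplittingField _ _ inst :=
      ⟨_, Polynomial.IsSplittingField.splittingField (f₁ * g),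
        IsSplittingField.finiteDimensional _ (f₁ * g), SplittingField.instNormal (f₁ * g)⟩
    have hinst : instA = DivisionRing.toRatAlgebra := Subsingleton.elim _ _
    subst hinst
    haveI hN : NumberField (f₁ * g).SplittingField :=
      @NumberField.mk _ _ (SplittingField.instCharZero (f₁ * g)) hFD
    haveI hG : IsGalois ℚ (f₁ * g).SplittingField :=
      { to_isSeparable := inferInstance, to_normal := hNo }
    exact ⟨(f₁ * g).SplittingField, inferInstance, hN, hG, hS⟩
  have hsplit : ((f₁ * g).map (algebraMap ℚ M)).Splits := IsSplittingField.splits M (f₁ * g)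
  have hmap0 : (f₁ * g).map (algebraMap ℚ M) ≠ 0 := map_ne_zero (mul_ne_zero hf₁0 hg0)
  have hf₁split : (f₁.map (algebraMap ℚ M)).Splits :=
    hsplit.of_dvd hmap0 (Polynomial.map_dvd _ (dvd_mul_right f₁ g))
  have hgsplit : (g.map (algebraMap ℚ M)).Splits :=
    hsplit.of_dvd hmap0 (Polynomial.map_dvd _ (dvd_mul_left g f₁))
  -- every automorphism of `M` has order dividing `6`; hence `p ∤ #Gal(M/ℚ)`
  have h6 : ∀ σ : M ≃ₐ[ℚ] M, σ ^ 6 = 1 := fun σ =>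
    pow_six_eq_one_of_isSplittingField_mul hf₁deg.le hgdeg.le hf₁0 hg0 σ
  have hpG : ¬ p ∣ Nat.card (M ≃ₐ[ℚ] M) := by
    intro hdvd
    obtain ⟨σ, hσ⟩ := exists_prime_orderOf_dvd_card' p hdvd
    have h' : p ∣ 6 := hσ ▸ orderOf_dvd_of_pow_eq_one (h6 σ)
    have h23 : p ∣ 2 * 3 := h'
    rcases (Nat.Prime.dvd_mul hp).mp h23 with h | h
    · have := (Nat.prime_dvd_prime_iff_eq hp Nat.prime_two).mp h
      omega
    · have := (Nat.prime_dvd_prime_iff_eq hp Nat.prime_three).mp h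
      omega
  -- (3) a root `β` of `X³ - pq` in `M` and `K₁ = ℚ(β) ≅ K`
  have hdegf : (f₁.map (algebraMap ℚ M)).degree ≠ 0 := by
    rw [degree_map, degree_eq_natDegree hf₁0, hf₁deg]; norm_num
  obtain ⟨β, hβ⟩ := hf₁split.exists_eval_eq_zero hdegf
  have hβ3 : β ^ 3 = ((p * q : ℕ) : M) := by
    rw [eval_map_algebraMap, hf₁def] at hβ
    simp only [map_natCast, aeval_sub, map_pow, aeval_X] at hβ
    exact sub_eq_zero.mp hβ
  set K₁ : IntermediateField ℚ M := ℚ⟮β⟯ with hK₁def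
  have hβint : IsIntegral ℚ β := .of_finite ℚ β
  have hminβ : minpoly ℚ β = f₁ := by rw [hf₁def]; exact minpoly_eq (K := M) hp hq hpq hβ3
  have hK₁3 : Module.finrank ℚ K₁ = 3 := by
    rw [hK₁def, IntermediateField.adjoin.finrank hβint, hminβ, hf₁deg]
  -- the cube root inside `K₁`
  set βK : K₁ := ⟨β, IntermediateField.mem_adjoin_simple_self ℚ β⟩ with hβKdef
  have hβK : βK ^ 3 = ((p * q : ℕ) : K₁) := Subtype.ext (by push_cast [hβKdef]; exact_mod_cast hβ3)
  -- (4) `C₁ = ℚ(roots of g) ≅ C`: Galois cubic, unramified away from `p`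
  set C₁ : IntermediateField ℚ M := IntermediateField.adjoin ℚ (g.rootSet M) with hC₁def
  haveI hC₁split : IsSplittingField ℚ C₁ g :=
    IntermediateField.adjoin_rootSet_isSplittingField hgsplit
  haveI hCsplit : IsSplittingField ℚ C g := by
    refine ⟨hgsplitC, ?_⟩
    rw [eq_top_iff, ← IntermediateField.top_toSubalgebra, ← hη,
      IntermediateField.adjoin_simple_toSubalgebra_of_isAlgebraic hηint.isAlgebraic]
    refine Algebra.adjoin_mono (Set.singleton_subset_iff.mpr ?_)
    rw [mem_rootSet_of_ne hg0]
    exact hgη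
  let e₁ : C ≃ₐ[ℚ] C₁ :=
    (IsSplittingField.algEquiv C g).trans (IsSplittingField.algEquiv C₁ g).symm
  have hC₁3 : Module.finrank ℚ C₁ = 3 := by rw [← e₁.toLinearEquiv.finrank_eq, hC3]
  have hC₁disc : ∀ {ℓ : ℕ}, ℓ.Prime → ℓ ≠ p → ¬ (ℓ : ℤ) ∣ NumberField.discr C₁ := by
    intro ℓ hℓ hℓp
    rw [← NumberField.discr_eq_discr_of_algEquiv C e₁]
    exact not_dvd_discr_of_intermediateField_cyclotomic (CyclotomicField p ℚ) C hℓ hℓp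
  -- unramified primes of `C₁` away from `p`, read on `𝓞 M`
  have ha : ∀ (Q : Ideal (𝓞 M)) [Q.IsMaximal], (p : 𝓞 M) ∉ Q →
      Algebra.IsUnramifiedAt ℤ (Q.under (𝓞 C₁)) := by
    intro Q _ hpQ
    have hQne : Q ≠ ⊥ := Ideal.IsMaximal.ne_bot_of_isIntegral_int Q
    haveI : Finite (𝓞 M ⧸ Q) := Ideal.finiteQuotientOfFreeOfNeBot Q hQne
    letI : Field (𝓞 M ⧸ Q) := Ideal.Quotient.field Q
    -- the residue characteristic `ℓ` of `Q`
    obtain ⟨ℓ, hℓchar⟩ := CharP.exists (𝓞 M ⧸ Q)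
    haveI := hℓchar
    have hℓprime : ℓ.Prime := CharP.char_is_prime (𝓞 M ⧸ Q) ℓ
    have hℓQ : (ℓ : 𝓞 M) ∈ Q := by
      rw [← Ideal.Quotient.eq_zero_iff_mem, map_natCast]
      exact CharP.cast_eq_zero (𝓞 M ⧸ Q) ℓ
    have hℓp : ℓ ≠ p := fun h => hpQ (h ▸ hℓQ)
    haveI : (Q.under (𝓞 C₁)).IsMaximal := Ideal.IsMaximal.under _ Q
    refine (NumberField.not_dvd_discr_iff_forall_mem C₁ (𝓞 C₁)
      (Nat.prime_iff_prime_int.mp hℓprime)).mp (hC₁disc hℓprime hℓp) (Q.under (𝓞 C₁))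
      inferInstance ?_
    rw [Ideal.under_def, Ideal.mem_comap, map_intCast, Int.cast_natCast]
    exact hℓQ
  -- (5) `E₂ = K₁(roots of g)`: Galois over `K₁`, `E₂ = K₁ C₁`, of degree `3`
  set E₂ : IntermediateField K₁ M := IntermediateField.adjoin K₁ (g.rootSet M) with hE₂def
  have hE : E₂.restrictScalars ℚ = K₁ ⊔ C₁ :=
    IntermediateField.restrictScalars_adjoin_eq_sup ℚ K₁ (g.rootSet M)
  have hrootK : (g.map (algebraMap ℚ K₁)).rootSet M = g.rootSet M := by
    simp only [rootSet, aroots_def, Polynomial.map_map, ← IsScalarTower.algebraMap_eq]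
  haveI : IsSplittingField K₁ E₂ (g.map (algebraMap ℚ K₁)) := by
    have hsK : ((g.map (algebraMap ℚ K₁)).map (algebraMap K₁ M)).Splits := by
      rwa [Polynomial.map_map, ← IsScalarTower.algebraMap_eq]
    have := IntermediateField.adjoin_rootSet_isSplittingField hsK
    rwa [hrootK] at this
  haveI : Normal K₁ E₂ := Normal.of_isSplittingField (g.map (algebraMap ℚ K₁))
  haveI : IsGalois K₁ E₂ := { to_isSeparable := inferInstance, to_normal := inferInstance }
  -- `X³ - pq` has no root in the field `C₁` (else `q` would be totally ramified in `C₁`,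
  -- which is unramified at `q ≠ p`), hence is irreducible over `C₁`
  have hirrC : Irreducible (f₁.map (algebraMap ℚ C₁)) := by
    have hdeg : (f₁.map (algebraMap ℚ C₁)).natDegree = 3 := by rw [natDegree_map, hf₁deg]
    have hne : f₁.map (algebraMap ℚ C₁) ≠ 0 := Polynomial.map_ne_zero hf₁0
    rw [irreducible_iff_roots_eq_zero_of_degree_le_three (by omega) (by omega),
      Multiset.eq_zero_iff_forall_notMem]
    intro γ hγ
    rw [mem_roots hne, IsRoot.def, eval_map_algebraMap] at hγ
    have hγ3 : γ ^ 3 = ((q * p : ℕ) : C₁) := by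
      rw [hf₁def] at hγ
      simp only [map_natCast, aeval_sub, map_pow, aeval_X] at hγ
      rw [mul_comm]
      exact sub_eq_zero.mp hγ
    -- a prime of `𝓞 C₁` above `q`
    haveI hqmax : (Ideal.span {(q : ℤ)}).IsMaximal :=
      Ideal.IsPrime.isMaximal
        ((Ideal.span_singleton_prime (by exact_mod_cast hq.ne_zero)).mpr
          (Nat.prime_iff_prime_int.mp hq)) (by simpa using hq.ne_zero)
    obtain ⟨Q₁, hQ₁max, hQ₁⟩ := Ideal.exists_ideal_over_maximal_of_isIntegral (S := 𝓞 C₁)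
      (Ideal.span {(q : ℤ)}) (by
        rw [(RingHom.injective_iff_ker_eq_bot _).mp (algebraMap ℤ (𝓞 C₁)).injective_int]
        exact bot_le)
    haveI := hQ₁max
    have hqQ₁ : (q : 𝓞 C₁) ∈ Q₁ := by
      have hmem : ((q : ℕ) : ℤ) ∈ Q₁.comap (algebraMap ℤ (𝓞 C₁)) := by
        rw [hQ₁]; exact Ideal.mem_span_singleton_self _
      rw [Ideal.mem_comap, map_natCast] at hmem
      exact hmem
    have hQ₁ne : Q₁ ≠ ⊥ := Ideal.IsMaximal.ne_bot_of_isIntegral_int Q₁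
    let v₁ : HeightOneSpectrum (𝓞 C₁) := ⟨Q₁, hQ₁max.isPrime, hQ₁ne⟩
    have he3 : Q₁.ramificationIdx ℤ = 3 :=
      ramificationIdx_eq_three hq hp hpq.symm hC₁3 hγ3 v₁ hqQ₁
    haveI : Algebra.IsUnramifiedAt ℤ Q₁ :=
      (NumberField.not_dvd_discr_iff_forall_mem C₁ (𝓞 C₁) (Nat.prime_iff_prime_int.mp hq)).mp
        (hC₁disc hq hpq.symm) Q₁ inferInstance (by rw [Int.cast_natCast]; exact hqQ₁)
    have he1 : Q₁.ramificationIdx ℤ = 1 := Ideal.ramificationIdx_eq_one Q₁ ℤ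
    omega
  -- (6) degrees: `[K₁C₁ : ℚ] = 9`, hence `[E₂ : K₁] = 3`
  set E₃ : IntermediateField C₁ M := IntermediateField.adjoin C₁ {β} with hE₃def
  have hE' : E₃.restrictScalars ℚ = K₁ ⊔ C₁ :=
    (IntermediateField.restrictScalars_adjoin_eq_sup ℚ C₁ {β}).trans (sup_comm _ _)
  have hE₃3 : Module.finrank C₁ E₃ = 3 := by
    have hβintC : IsIntegral C₁ β := .of_finite C₁ β
    have hmin : minpoly C₁ β = f₁.map (algebraMap ℚ C₁) := by
      refine (minpoly.eq_of_irreducible_of_monic hirrC ?_ (hf₁monic.map _)).symm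
      rw [aeval_map_algebraMap, ← hminβ]
      exact minpoly.aeval ℚ β
    rw [hE₃def, IntermediateField.adjoin.finrank hβintC, hmin, natDegree_map, hf₁deg]
  have h9 : Module.finrank ℚ (E₃.restrictScalars ℚ) = 9 := by
    haveI : Module.Free C₁ E₃ := Module.Free.of_divisionRing C₁ E₃
    haveI : Module.Free ℚ C₁ := Module.Free.of_divisionRing ℚ C₁
    change Module.finrank ℚ E₃ = 9
    rw [← Module.finrank_mul_finrank ℚ C₁ E₃, hC₁3, hE₃3]
  have h9' : Module.finrank ℚ (E₂.restrictScalars ℚ) = 9 := by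
    rw [← h9]
    exact (IntermediateField.equivOfEq (hE.trans hE'.symm)).toLinearEquiv.finrank_eq
  have hE3 : Module.finrank K₁ E₂ = 3 := by
    haveI : Module.Free K₁ E₂ := Module.Free.of_divisionRing K₁ E₂
    haveI : Module.Free ℚ K₁ := Module.Free.of_divisionRing ℚ K₁
    have h := Module.finrank_mul_finrank ℚ K₁ E₂
    rw [hK₁3] at h
    change 3 * Module.finrank K₁ E₂ = Module.finrank ℚ (E₂.restrictScalars ℚ) at h
    rw [h9'] at h
    omega
  -- (7) above `p`: `e(𝔔 | p) = #I(𝔔) ≤ 6 < 9 = 3 e(𝔔 ∩ K₁ | p)`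
  have hb : ∀ (Q : Ideal (𝓞 M)) [Q.IsMaximal], (p : 𝓞 M) ∈ Q →
      Q.ramificationIdx ℤ < 3 * (Q.under (𝓞 K₁)).ramificationIdx ℤ := by
    intro Q _ hpQ
    haveI : (Q.under (𝓞 K₁)).IsMaximal := Ideal.IsMaximal.under _ Q
    have hne : Q.under (𝓞 K₁) ≠ ⊥ := Ideal.IsMaximal.ne_bot_of_isIntegral_int _
    let v : HeightOneSpectrum (𝓞 K₁) := ⟨Q.under (𝓞 K₁), Ideal.IsMaximal.isPrime inferInstance, hne⟩
    have hpv : (p : 𝓞 K₁) ∈ v.asIdeal := by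
      change (p : 𝓞 K₁) ∈ Q.under (𝓞 K₁)
      rw [Ideal.under_def, Ideal.mem_comap, map_natCast]
      exact hpQ
    have he3 : (Q.under (𝓞 K₁)).ramificationIdx ℤ = 3 :=
      ramificationIdx_eq_three hp hq hpq hK₁3 hβK v hpv
    have hI : Q.ramificationIdx ℤ ≤ 6 := by
      rw [← card_inertia_eq_ramificationIdx_int M (M ≃ₐ[ℚ] M) Q]
      haveI := isCyclic_inertia_of_not_dvd_card hp hpG Q hpQ
      obtain ⟨γ, hγ⟩ := IsCyclic.exists_ofOrder_eq_natCard (α := Q.inertia (M ≃ₐ[ℚ] M))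
      rw [← hγ]
      refine Nat.le_of_dvd (by norm_num) (orderOf_dvd_of_pow_eq_one (Subtype.ext ?_))
      rw [Subgroup.coe_pow, Subgroup.coe_one]
      exact h6 γ
    omega
  -- (8) `E₂/K₁` is an unramified cyclic cubic extension, so `3 ∣ h(K₁)`
  have hunr : ∀ v : HeightOneSpectrum (𝓞 K₁), Algebra.IsUnramifiedIn (𝓞 E₂) v.asIdeal :=
    isUnramifiedIn_compositum K₁ C₁ E₂ hE hE3 ha hb
  have hcard : Nat.card (E₂ ≃ₐ[K₁] E₂) = 3 := by rw [IsGalois.card_aut_eq_finrank, hE3]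
  have h3K₁ : 3 ∣ classNumber K₁ :=
    dvd_classNumber_of_isUnramifiedIn_of_odd_prime_card K₁ E₂ Nat.prime_three (by norm_num)
      hcard hunr
  -- (9) transport along `K ≃ ℚ(β) = K₁`
  have hαint : IsIntegral ℚ α := .of_finite ℚ α
  have hminα : minpoly ℚ α = f₁ := by rw [hf₁def]; exact minpoly_eq hp hq hpq hα
  let e₂ : ℚ⟮α⟯ ≃ₐ[ℚ] K₁ :=
    (IntermediateField.adjoinRootEquivAdjoin ℚ hαint).symm.trans
      ((AdjoinRoot.algEquivOfEq ℚ _ _ (hminα.trans hminβ.symm)).trans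
        (IntermediateField.adjoinRootEquivAdjoin ℚ hβint))
  have htop : ℚ⟮α⟯ = ⊤ := adjoin_eq_top hp hq hpq h3 hα
  let e₃ : K ≃ₐ[ℚ] ℚ⟮α⟯ :=
    IntermediateField.topEquiv.symm.trans (IntermediateField.equivOfEq htop.symm)
  rw [classNumber_eq_of_ringEquiv (e₃.trans e₂).toRingEquiv]
  exact h3K₁


/-- **Genus theory for `ℚ(∛(pq))`, symmetric form**: if `p ≡ 1 (mod 3)` or `q ≡ 1 (mod 3)` then
`3 ∣ h(K)` for every cubic number field `K ∋ ∛(pq)` — the case "a prime divisor of the conductor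
`f = pq` splits in `ℚ(ζ₃)`" (`s̃ ≥ 1`, rank `r ≥ s̃`) of [AouissiMayerIsmailiTalbiAzizi2020, (2.3)],
which is one half of the direction `¬(p, q ≡ 2,5 (mod 9)) ⟹ 3 ∣ h_K` of
`Honda1971_three_dvd_classNumber_twoPrimes`. [cite: AouissiMayerIsmailiTalbiAzizi2020, §2.3 eq. (2.3)] -/
theorem three_dvd_classNumber_of_mod_three_eq_one {p q : ℕ} (hp : p.Prime) (hq : q.Prime)
    (hpq : p ≠ q) (h1 : p % 3 = 1 ∨ q % 3 = 1) (K : Type) [Field K] [NumberField K]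
    (h3 : Module.finrank ℚ K = 3) {α : K} (hα : α ^ 3 = ((p * q : ℕ) : K)) :
    3 ∣ classNumber K := by
  rcases h1 with h | h
  · exact three_dvd_classNumber_of_prime_mod_three hp hq hpq h K h3 hα
  · exact three_dvd_classNumber_of_prime_mod_three hq hp hpq.symm h K h3 (by rwa [Nat.mul_comm])


/-! ### `p ∣ h` ascends along extensions of degree prime to `p` -/

/-- **`p ∣ h(K)` persists in extensions of degree prime to `p`.**  If `L/K` is an extension of
number fields with `p ∤ [L : K]` and `p ∣ h(K)`, then `p ∣ h(L)`: a class `[𝔞]` of order `p` in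
`Cl(K)` cannot capitulate in `L`, since `𝔞𝓞_L = (y)` gives `𝔞^{[L:K]} = N_{L/K}(𝔞𝓞_L) = (N y)`
(Mathlib `Ideal.relNorm_algebraMap`; tree `Serre1964.isPrincipal_pow_finrank_of_isPrincipal_map`);
and `[𝔞𝓞_L] ≠ 1` with `[𝔞𝓞_L]^p = 1` forces `p ∣ h(L)`.  (Used with `L = K(ζ₃)`, `[L:K] = 2`,
`p = 3`: `3 ∣ h_K ⟹ 3 ∣ h_{K(ζ₃)}`, the easy half of Honda's `3 ∣ h_K ⟺ 3 ∣ h_k`.)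
Ref: L. C. Washington, *Introduction to Cyclotomic Fields*, proof of Thm. 10.4(b)-type norm
argument; folklore. [folklore] -/
theorem dvd_classNumber_of_dvd_classNumber_of_not_dvd_finrank {K L : Type*} [Field K]
    [NumberField K] [Field L] [NumberField L] [Algebra K L] {p : ℕ} (hp : p.Prime)
    (hK : p ∣ classNumber K) (hpn : ¬ p ∣ Module.finrank K L) : p ∣ classNumber L := by
  classical
  haveI : Fact p.Prime := ⟨hp⟩
  by_contra hL
  -- a class of order `p` in `Cl(K)`, represented by an integral ideal `I`
  have hK' : p ∣ Fintype.card (ClassGroup (𝓞 K)) := hK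
  obtain ⟨c, hc⟩ := exists_prime_orderOf_dvd_card p hK'
  obtain ⟨I, rfl⟩ := ClassGroup.mk0_surjective c
  have hI0 : (I : Ideal (𝓞 K)) ≠ ⊥ := nonZeroDivisors.ne_zero I.2
  -- `I^p` is principal
  have hIp : ((I : Ideal (𝓞 K)) ^ p).IsPrincipal := by
    rw [← ClassGroup.mk0_eq_one_iff (pow_mem I.2 p)]
    have : ClassGroup.mk0 (⟨(I : Ideal (𝓞 K)) ^ p, pow_mem I.2 p⟩ : (Ideal (𝓞 K))⁰) =
        ClassGroup.mk0 I ^ p := by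
      rw [← map_pow]; rfl
    rw [this, ← hc, pow_orderOf_eq_one]
  -- the extended ideal `J = I 𝓞_L` and its class, killed by `p`
  set J : Ideal (𝓞 L) := (I : Ideal (𝓞 K)).map (algebraMap (𝓞 K) (𝓞 L)) with hJdef
  have hJ0 : J ≠ ⊥ := by
    rw [hJdef, Ne, Ideal.map_eq_bot_iff_of_injective (RingOfIntegers.algebraMap.injective K L)]
    exact hI0
  have hJmem : J ∈ (Ideal (𝓞 L))⁰ := mem_nonZeroDivisors_of_ne_zero hJ0
  have hJp : (J ^ p).IsPrincipal := by
    obtain ⟨x, hx⟩ := hIp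
    refine ⟨algebraMap (𝓞 K) (𝓞 L) x, ?_⟩
    rw [Ideal.submodule_span_eq] at hx ⊢
    rw [hJdef, ← Ideal.map_pow, hx, Ideal.map_span, Set.image_singleton]
  have hd : ClassGroup.mk0 ⟨J, hJmem⟩ = 1 := by
    -- its order divides `p` and `h(L)`, which is prime to `p`
    have hdp : ClassGroup.mk0 ⟨J, hJmem⟩ ^ p = 1 := by
      rw [← (ClassGroup.mk0_eq_one_iff (pow_mem hJmem p)).2 hJp, ← map_pow]
      rfl
    have hord : orderOf (ClassGroup.mk0 ⟨J, hJmem⟩) ∣ p := orderOf_dvd_of_pow_eq_one hdp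
    rcases (Nat.dvd_prime hp).mp hord with h1 | h2
    · exact orderOf_eq_one_iff.mp h1
    · exfalso
      apply hL
      have := orderOf_dvd_card (x := ClassGroup.mk0 ⟨J, hJmem⟩)
      rw [h2] at this
      exact this
  have hJ : J.IsPrincipal := (ClassGroup.mk0_eq_one_iff hJmem).mp hd
  -- hence `I ^ [L:K]` is principal, so `p = ord [I] ∣ [L:K]`
  have hpow := Literature.Barriers.HodgeConjecture.Serre1964.isPrincipal_pow_finrank_of_isPrincipal_map
    (R := 𝓞 K) (S := 𝓞 L) hJ
  rw [Literature.Barriers.HodgeConjecture.Serre1964.finrank_fractionRing_ringOfIntegers K L] at hpow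
  have h1 : ClassGroup.mk0 I ^ Module.finrank K L = 1 := by
    rw [← (ClassGroup.mk0_eq_one_iff (pow_mem I.2 _)).2 hpow, ← map_pow]
    rfl
  exact hpn (hc ▸ orderOf_dvd_of_pow_eq_one h1)


/-! ### Toward the cases through `k = K(ζ₃)`: the cube root of `(p)` and the cubic character of `ζ₃` -/

/-- **`(p, α)³ = (p)` for `α³ = pq`, `(p, q) = 1`** — the cube root of the ideal `(p)` in any
commutative ring containing a cube root `α` of `pq`: `(p, α)² ⊆ (p, α²)`, `(p, α)(p, α²) ⊆ (p)`
(as `α³ = pq`), and `p = a p³ + b α³` from `a p² + b q = 1`. [folklore] -/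
theorem span_pair_pow_three_eq_span {R : Type*} [CommRing R] {p q α a b : R}
    (hα : α ^ 3 = p * q) (hab : a * p ^ 2 + b * q = 1) :
    Ideal.span {p, α} ^ 3 = Ideal.span {p} := by
  apply le_antisymm
  · -- `(p, α)² ≤ (p, α²)`
    have h2 : Ideal.span {p, α} * Ideal.span {p, α} ≤ Ideal.span {p, α ^ 2} := by
      rw [Ideal.mul_le]
      intro x hx y hy
      obtain ⟨c, d, rfl⟩ := Ideal.mem_span_pair.mp hx
      obtain ⟨e, f, rfl⟩ := Ideal.mem_span_pair.mp hy
      refine Ideal.mem_span_pair.mpr ⟨c * e * p + c * f * α + d * e * α, d * f, ?_⟩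
      ring
    -- `(p, α²)(p, α) ≤ (p)`
    have h3 : Ideal.span {p, α ^ 2} * Ideal.span {p, α} ≤ Ideal.span {p} := by
      rw [Ideal.mul_le]
      intro x hx y hy
      obtain ⟨c, d, rfl⟩ := Ideal.mem_span_pair.mp hx
      obtain ⟨e, f, rfl⟩ := Ideal.mem_span_pair.mp hy
      refine Ideal.mem_span_singleton.mpr ⟨c * e * p + c * f * α + d * e * α ^ 2 + d * f * q, ?_⟩
      linear_combination d * f * hα
    calc Ideal.span {p, α} ^ 3
        = Ideal.span {p, α} * Ideal.span {p, α} * Ideal.span {p, α} := by rw [pow_three, mul_assoc]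
      _ ≤ Ideal.span {p, α ^ 2} * Ideal.span {p, α} := Ideal.mul_mono_left h2
      _ ≤ Ideal.span {p} := h3
  · -- `p = a p³ + b α³ ∈ (p, α)³`
    rw [Ideal.span_singleton_le_iff_mem]
    have hp3 : p ^ 3 ∈ Ideal.span {p, α} ^ 3 :=
      Ideal.pow_mem_pow (Ideal.subset_span (by simp)) 3
    have hα3 : α ^ 3 ∈ Ideal.span {p, α} ^ 3 :=
      Ideal.pow_mem_pow (Ideal.subset_span (by simp)) 3
    have : p = a * p ^ 3 + b * α ^ 3 := by
      rw [hα]; linear_combination -(p * hab)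
    have key : a * p ^ 3 + b * α ^ 3 ∈ Ideal.span {p, α} ^ 3 :=
      Ideal.add_mem _ (Ideal.mul_mem_left _ _ hp3) (Ideal.mul_mem_left _ _ hα3)
    rwa [← this] at key

/-- **An element of order `3` is not a cube in a field with `p²` elements, `p ≡ 2, 5 (mod 9)`.**
If `ω = c³` then `c` has order `9`, so `9 ∣ p² − 1`, i.e. `p ≡ ±1 (mod 9)`.  (Applied to the
residue field `𝓞_{ℚ(ζ₃)}/(p) ≅ 𝔽_{p²}` of a prime `p ≡ 2 (mod 3)`: `ζ₃` is a cube modulo `p` iff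
`p ≡ 8 (mod 9)` — the local condition deciding whether `ζ₃` is a norm from `ℚ(ζ₃, ∛(pq))`,
[AouissiMayerIsmailiTalbiAzizi2020, proof of Thm. 2.3: "`ζ₃` can be norm of a unit in `k` only if
the prime factors of `f` are `3` or `ℓ_j ≡ 1, 8 (mod 9)`"].) [folklore] -/
theorem pow_three_ne_of_orderOf_eq_three {F : Type*} [Field F] [Fintype F] {p f : ℕ}
    (hF : Fintype.card F = p ^ f) (hf : f = 1 ∨ f = 2) (hp : p % 9 = 2 ∨ p % 9 = 5) {ω : F}
    (hω : orderOf ω = 3) (c : F) : c ^ 3 ≠ ω := by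
  classical
  intro hc
  have hω1 : ω ≠ 1 := by
    rintro rfl
    rw [orderOf_one] at hω
    exact absurd hω (by norm_num)
  have hc0 : c ≠ 0 := by
    rintro rfl
    apply hω1
    rw [← hc]
    have h0 : orderOf (0 : F) = 0 := orderOf_eq_zero_iff'.mpr fun n hn => by
      rw [zero_pow hn.ne']; exact zero_ne_one
    rw [← hc, zero_pow three_ne_zero, h0] at hω
    exact absurd hω (by norm_num)
  -- the unit `c` has order `9`
  set u : Fˣ := Units.mk0 c hc0 with hu
  have hu3 : u ^ 3 ≠ 1 := by
    intro h
    apply hω1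
    have : ((u ^ 3 : Fˣ) : F) = 1 := by rw [h, Units.val_one]
    rwa [Units.val_pow_eq_pow_val, Units.val_mk0, hc] at this
  have hu9 : u ^ 9 = 1 := by
    apply Units.ext
    rw [Units.val_pow_eq_pow_val, Units.val_mk0, Units.val_one,
      show (9 : ℕ) = 3 * 3 by norm_num, pow_mul, hc, ← hω, pow_orderOf_eq_one]
  have hord : orderOf u = 9 := by
    have hdvd : orderOf u ∣ 3 ^ 2 := orderOf_dvd_of_pow_eq_one hu9
    rw [Nat.dvd_prime_pow Nat.prime_three] at hdvd
    obtain ⟨k, hk, hk'⟩ := hdvd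
    have hk1 : k ≠ 0 := by
      rintro rfl
      apply hu3
      rw [pow_zero, orderOf_eq_one_iff] at hk'
      rw [hk', one_pow]
    have hk2 : k ≠ 1 := by
      rintro rfl
      apply hu3
      rw [pow_one] at hk'
      rw [← hk', pow_orderOf_eq_one]
    have hk3 : k = 2 := by omega
    rw [hk', hk3]
    norm_num
  -- hence `9 ∣ #Fˣ = p^f - 1`
  have hdvd : 9 ∣ p ^ f - 1 := by
    have h := orderOf_dvd_card (x := u)
    rw [hord, Fintype.card_units, hF] at h
    exact h
  -- impossible for `p ≡ 2, 5 (mod 9)` and `f ≤ 2`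
  have hpf : p ^ f % 9 = 2 ∨ p ^ f % 9 = 5 ∨ p ^ f % 9 = 4 ∨ p ^ f % 9 = 7 := by
    rcases hf with rfl | rfl <;> rcases hp with h | h <;> simp [Nat.pow_mod, h]
  have hpos : 1 ≤ p ^ f := Nat.one_le_pow _ _ (by omega)
  omega

/-- **A primitive cube root of unity keeps order `3` modulo every prime not above `3`.**  If
`ω² + ω + 1 = 0` in a commutative ring `R` and `P` is a prime ideal containing a rational prime
`p` coprime to `3`, then `ω mod P` has multiplicative order `3` (`ω ≡ 1` would give
`3ω = (ω² + ω + 1) − (ω − 1)² ∈ P`, so `3 ∈ P ∋ p`). [folklore] -/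
theorem orderOf_mk_eq_three {R : Type*} [CommRing R] {ω : R} (hω : ω ^ 2 + ω + 1 = 0)
    (P : Ideal R) [hP : P.IsPrime] {p : ℕ} (hp : (p : R) ∈ P) (hp3 : Nat.Coprime p 3) :
    orderOf (Ideal.Quotient.mk P ω) = 3 := by
  haveI : Fact (Nat.Prime 3) := ⟨Nat.prime_three⟩
  have hω3 : ω ^ 3 = 1 := by linear_combination (ω - 1) * hω
  refine orderOf_eq_prime ?_ ?_
  · rw [← map_pow, hω3, map_one]
  · intro h1
    have hmem : ω - 1 ∈ P := by
      rw [← Ideal.Quotient.eq, h1, map_one]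
    have h3ω : (3 : R) * ω ∈ P := by
      have h : (3 : R) * ω = (ω ^ 2 + ω + 1) - (ω - 1) * (ω - 1) := by ring
      rw [h, hω, zero_sub]
      exact P.neg_mem (P.mul_mem_left (ω - 1) hmem)
    have hωP : ω ∉ P := fun h => hP.ne_top ((Ideal.eq_top_iff_one _).mpr (by
      have h' : ω ^ 3 ∈ P := P.pow_mem_of_mem h 3 (by norm_num)
      rwa [hω3] at h'))
    have h3 : (3 : R) ∈ P := (hP.mem_or_mem h3ω).resolve_right hωP
    have hcop : IsCoprime (p : R) (3 : R) := by
      have h' : IsCoprime (p : ℤ) (3 : ℤ) := Nat.isCoprime_iff_coprime.mpr hp3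
      simpa using h'.map (Int.castRingHom R)
    obtain ⟨a, b, hab⟩ := hcop
    exact hP.ne_top ((Ideal.eq_top_iff_one _).mpr
      (hab ▸ P.add_mem (P.mul_mem_left a hp) (P.mul_mem_left b h3)))


/-! ### Ambiguous classes exist: a `p`-group of automorphisms fixes a class of order `p` -/

section FixedPoints

open MulAction

/-- **A `p`-group of automorphisms of a finite abelian group of order divisible by `p` fixes a
non-trivial element of order `p`.**  (`G` acts on the `p`-torsion `A[p]`, a non-trivial `p`-group by
Cauchy; the number of fixed points is `≡ #A[p] ≡ 0 (mod p)` and `1` is fixed.)  This is the step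
"`3 ∣ h_k ⟹ C_k^G` contains a class of order `3`" (`G = Gal(k/ℚ(ζ₃)) ≅ C₃`) of Honda's proof,
[AouissiMayerIsmailiTalbiAzizi2020, Thm. 2.3: `3 ∤ #C_{k,3}^{(σ)} ⟺ 3 ∤ h_k`]. [folklore] -/
theorem exists_fixed_ne_one_pow_eq_one {G A : Type*} [Group G] [CommGroup A] [Finite A]
    [MulDistribMulAction G A] {p : ℕ} [hp : Fact p.Prime] (hG : IsPGroup p G)
    (hA : p ∣ Nat.card A) : ∃ a : A, a ≠ 1 ∧ a ^ p = 1 ∧ ∀ g : G, g • a = a := by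
  classical
  -- the `p`-torsion subgroup and the induced action
  let T : Subgroup A := (powMonoidHom p : A →* A).ker
  have hmemT : ∀ {a : A}, a ∈ T ↔ a ^ p = 1 := fun {a} => by
    simp [T, MonoidHom.mem_ker, powMonoidHom_apply]
  letI : MulAction G T :=
    { smul := fun g a => ⟨g • (a : A), by
        rw [hmemT, ← smul_pow', (hmemT).mp a.2, smul_one]⟩
      one_smul := fun a => Subtype.ext (one_smul G (a : A))
      mul_smul := fun g h a => Subtype.ext (mul_smul g h (a : A)) }
  have hcoe : ∀ (g : G) (a : T), ((g • a : T) : A) = g • (a : A) := fun _ _ => rfl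
  -- `T` is a non-trivial `p`-group, so `p ∣ #T`
  have hT : IsPGroup p T := fun a => ⟨1, Subtype.ext (by
    rw [pow_one, Subgroup.coe_pow, Subgroup.coe_one]; exact (hmemT).mp a.2)⟩
  obtain ⟨a₀, ha₀⟩ := exists_prime_orderOf_dvd_card' (G := A) p hA
  have ha₀T : a₀ ∈ T := (hmemT).mpr (ha₀ ▸ pow_orderOf_eq_one a₀)
  have ha₀1 : a₀ ≠ 1 := by
    rintro rfl
    rw [orderOf_one] at ha₀
    exact hp.out.one_lt.ne ha₀
  have hpT : p ∣ Nat.card T := by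
    rcases hT.card_eq_or_dvd with h1 | hdvd
    · exfalso
      have hsub : Subsingleton T := (Nat.card_eq_one_iff_unique.mp h1).1
      exact ha₀1 (congrArg Subtype.val (hsub.elim ⟨a₀, ha₀T⟩ ⟨1, T.one_mem⟩))
    · exact hdvd
  -- `1 ∈ T` is fixed; get another fixed point
  have h1 : (⟨1, T.one_mem⟩ : T) ∈ fixedPoints G T := fun g => Subtype.ext (by
    rw [hcoe]; exact smul_one g)
  obtain ⟨b, hb, hb1⟩ := hG.exists_fixed_point_of_prime_dvd_card_of_fixed_point T hpT h1
  refine ⟨b, fun h => hb1 (Subtype.ext h.symm), (hmemT).mp b.2, fun g => ?_⟩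
  have := hb g
  rw [Subtype.ext_iff, hcoe] at this
  exact this

end FixedPoints


/-! ### The Galois action on the class group: functoriality of `ClassGroup.mulEquiv`, ambiguous classes -/

section ClassGroupFunctor

variable {R : Type*} [CommRing R] [IsDomain R] {R' : Type*} [CommRing R'] [IsDomain R']
  {R'' : Type*} [CommRing R''] [IsDomain R'']

/-- `ClassGroup.mulEquiv` on the class of an invertible fractional ideal: it is the class of the
transported fractional ideal. [folklore] -/
theorem classGroup_mulEquiv_mk (g : R ≃+* R') (I : (FractionalIdeal R⁰ (FractionRing R))ˣ) :
    ClassGroup.mulEquiv g (ClassGroup.mk (FractionRing R) I) =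
      ClassGroup.mk (FractionRing R') (Units.mapEquiv
        (FractionalIdeal.ringEquivOfRingEquiv (FractionRing R) (FractionRing R') g).toMulEquiv I) := by
  rw [ClassGroup.mulEquiv, MulEquiv.trans_apply, MulEquiv.trans_apply, ClassGroup.equiv_mk,
    MulEquiv.symm_apply_eq, ClassGroup.equiv_mk, QuotientGroup.congr_mk']
  congr 1
  ext1
  simp [FractionalIdeal.canonicalEquiv_self]

/-- Functoriality of `ClassGroup.mulEquiv`: identity. [folklore] -/
theorem classGroup_mulEquiv_refl :
    ClassGroup.mulEquiv (RingEquiv.refl R) = MulEquiv.refl (ClassGroup R) := by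
  refine MulEquiv.ext fun c => ClassGroup.induction (FractionRing R) (fun I => ?_) c
  rw [classGroup_mulEquiv_mk, MulEquiv.refl_apply, FractionalIdeal.ringEquivOfRingEquiv_refl]
  rfl

/-- Functoriality of `ClassGroup.mulEquiv`: composition. [folklore] -/
theorem classGroup_mulEquiv_trans (g : R ≃+* R') (h : R' ≃+* R'') :
    ClassGroup.mulEquiv (g.trans h) = (ClassGroup.mulEquiv g).trans (ClassGroup.mulEquiv h) := by
  refine MulEquiv.ext fun c => ClassGroup.induction (FractionRing R) (fun I => ?_) c
  rw [MulEquiv.trans_apply, classGroup_mulEquiv_mk, classGroup_mulEquiv_mk,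
    classGroup_mulEquiv_mk, FractionalIdeal.ringEquivOfRingEquiv_trans (FractionRing R)
      (FractionRing R') (FractionRing R'')]
  rfl

end ClassGroupFunctor

section AmbiguousClass

open MulAction

/-- **The Galois action on the class group fixes a class of order `p`.**  For number fields
`K ⊆ L` with `Gal(L/K)` a `p`-group and `p ∣ h(L)`, some class `c ≠ 1` with `c^p = 1` is fixed by
every `σ ∈ Gal(L/K)` (acting through `ClassGroup.mulEquiv (RingOfIntegers.mapRingEquiv σ)`):
the ambiguous `p`-classes are non-trivial. [folklore] -/
theorem exists_fixed_class_of_dvd_classNumber {K L : Type*} [Field K] [Field L] [NumberField L]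
    [Algebra K L] {p : ℕ} [Fact p.Prime] (hG : IsPGroup p (L ≃ₐ[K] L))
    (hL : p ∣ classNumber L) :
    ∃ c : ClassGroup (𝓞 L), c ≠ 1 ∧ c ^ p = 1 ∧
      ∀ σ : L ≃ₐ[K] L, ClassGroup.mulEquiv (RingOfIntegers.mapRingEquiv σ.toRingEquiv) c = c := by
  classical
  -- the action `σ ↦ ClassGroup.mulEquiv (mapRingEquiv σ)` as a homomorphism to `MulAut`
  have hmap_refl : RingOfIntegers.mapRingEquiv (AlgEquiv.refl : L ≃ₐ[K] L).toRingEquiv =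
      RingEquiv.refl (𝓞 L) := RingEquiv.ext fun x => Subtype.ext rfl
  have hmap_trans : ∀ σ τ : L ≃ₐ[K] L,
      RingOfIntegers.mapRingEquiv (σ * τ).toRingEquiv =
        (RingOfIntegers.mapRingEquiv τ.toRingEquiv).trans
          (RingOfIntegers.mapRingEquiv σ.toRingEquiv) :=
    fun σ τ => RingEquiv.ext fun x => Subtype.ext rfl
  let φ : (L ≃ₐ[K] L) →* MulAut (ClassGroup (𝓞 L)) :=
    { toFun := fun σ => ClassGroup.mulEquiv (RingOfIntegers.mapRingEquiv σ.toRingEquiv)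
      map_one' := by
        change ClassGroup.mulEquiv (RingOfIntegers.mapRingEquiv
          (AlgEquiv.refl : L ≃ₐ[K] L).toRingEquiv) = _
        rw [hmap_refl, classGroup_mulEquiv_refl]
        rfl
      map_mul' := fun σ τ => by
        change ClassGroup.mulEquiv (RingOfIntegers.mapRingEquiv (σ * τ).toRingEquiv) = _
        rw [hmap_trans, classGroup_mulEquiv_trans]
        rfl }
  letI : MulDistribMulAction (L ≃ₐ[K] L) (ClassGroup (𝓞 L)) :=
    MulDistribMulAction.compHom _ φ
  have hsmul : ∀ (σ : L ≃ₐ[K] L) (c : ClassGroup (𝓞 L)),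
      σ • c = ClassGroup.mulEquiv (RingOfIntegers.mapRingEquiv σ.toRingEquiv) c := fun _ _ => rfl
  have hcard : p ∣ Nat.card (ClassGroup (𝓞 L)) := by
    rwa [Nat.card_eq_fintype_card]
  obtain ⟨c, hc1, hcp, hfix⟩ := exists_fixed_ne_one_pow_eq_one hG hcard
  exact ⟨c, hc1, hcp, fun σ => (hsmul σ c).symm.trans (hfix σ)⟩

end AmbiguousClass


/-! ### `ζ₃` is not a norm from `k` when a prime `p ≡ 2, 5 (mod 9)` is totally ramified -/

section TotallyRamifiedNorm

variable {F L : Type*} [Field F] [Field L] [NumberField L] [Algebra F L]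

omit [NumberField L] in
/-- If every `σ ∈ Gal(L/F)` acts trivially modulo the prime `P` (i.e. `Gal(L/F)` is the inertia
group of `P`: `P` is totally ramified in `L/F`), then `P` and its powers are `Gal(L/F)`-stable.
[folklore] -/
theorem smul_mem_pow_iff_of_inertia (P : Ideal (𝓞 L)) [P.IsMaximal]
    (hinert : ∀ (σ : L ≃ₐ[F] L) (x : 𝓞 L), σ • x - x ∈ P) (σ : L ≃ₐ[F] L) (n : ℕ) (r : 𝓞 L) :
    σ • r ∈ P ^ n ↔ r ∈ P ^ n := by
  -- `P` is stable under every `τ`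
  have hstab : ∀ (τ : L ≃ₐ[F] L) (x : 𝓞 L), x ∈ P → τ • x ∈ P := fun τ x hx => by
    have h := P.add_mem (hinert τ x) hx
    rwa [sub_add_cancel] at h
  let e : (L ≃ₐ[F] L) → (𝓞 L ≃+* 𝓞 L) := fun τ => MulSemiringAction.toRingEquiv _ (𝓞 L) τ
  have he : ∀ τ x, e τ x = τ • x := fun _ _ => rfl
  have hmap : ∀ τ, P.map (e τ : 𝓞 L →+* 𝓞 L) = P := fun τ => by
    apply le_antisymm
    · rw [Ideal.map_le_iff_le_comap]
      intro x hx
      rw [Ideal.mem_comap, RingHom.coe_coe, he]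
      exact hstab τ x hx
    · intro x hx
      have hx' : x = e τ (τ⁻¹ • x) := by rw [he, smul_inv_smul]
      rw [hx']
      exact Ideal.mem_map_of_mem _ (hstab τ⁻¹ x hx)
  have hmapn : (P ^ n).map (e σ : 𝓞 L →+* 𝓞 L) = P ^ n := by
    rw [Ideal.map_pow, hmap]
  constructor
  · intro h
    have h' : e σ r ∈ (P ^ n).map (e σ : 𝓞 L →+* 𝓞 L) := by rwa [hmapn, he]
    rw [Ideal.map_comap_of_equiv, Ideal.mem_comap] at h'
    simpa using h'
  · intro h
    have h' : e σ r ∈ (P ^ n).map (e σ : 𝓞 L →+* 𝓞 L) := Ideal.mem_map_of_mem _ h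
    rwa [hmapn, he] at h'

/-- Under the same hypothesis the `P`-adic valuation is `Gal(L/F)`-invariant on `𝓞 L`.
[folklore] -/
theorem intValuation_smul_of_inertia (v : HeightOneSpectrum (𝓞 L))
    (hinert : ∀ (σ : L ≃ₐ[F] L) (x : 𝓞 L), σ • x - x ∈ v.asIdeal) (σ : L ≃ₐ[F] L) (r : 𝓞 L) :
    v.intValuation (σ • r) = v.intValuation r := by
  by_cases hr : r = 0
  · rw [hr, smul_zero]
  have hσr : σ • r ≠ 0 := fun h => hr (by rw [← inv_smul_smul σ r, h, smul_zero])
  apply le_antisymm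
  · obtain ⟨m, hm⟩ : ∃ m : ℕ, v.intValuation r = WithZero.exp (-(m : ℤ)) :=
      ⟨_, v.intValuation_if_neg hr⟩
    rw [hm, v.intValuation_le_pow_iff_mem, smul_mem_pow_iff_of_inertia v.asIdeal hinert,
      ← v.intValuation_le_pow_iff_mem, hm]
  · obtain ⟨m, hm⟩ : ∃ m : ℕ, v.intValuation (σ • r) = WithZero.exp (-(m : ℤ)) :=
      ⟨_, v.intValuation_if_neg hσr⟩
    rw [hm, v.intValuation_le_pow_iff_mem, ← smul_mem_pow_iff_of_inertia v.asIdeal hinert σ,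
      ← v.intValuation_le_pow_iff_mem, hm]

/-- … and the `P`-adic valuation is `Gal(L/F)`-invariant on `L`. [folklore] -/
theorem valuation_smul_of_inertia (v : HeightOneSpectrum (𝓞 L))
    (hinert : ∀ (σ : L ≃ₐ[F] L) (x : 𝓞 L), σ • x - x ∈ v.asIdeal) (σ : L ≃ₐ[F] L) (x : L) :
    v.valuation L (σ x) = v.valuation L x := by
  obtain ⟨a, b, _hb, rfl⟩ := IsFractionRing.div_surjective (A := 𝓞 L) x
  rw [map_div₀, map_div₀, map_div₀]
  change v.valuation L ((σ • a : 𝓞 L) : L) / v.valuation L ((σ • b : 𝓞 L) : L) = _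
  rw [show ((σ • a : 𝓞 L) : L) = algebraMap (𝓞 L) L (σ • a) from rfl,
    show ((σ • b : 𝓞 L) : L) = algebraMap (𝓞 L) L (σ • b) from rfl,
    v.valuation_of_algebraMap, v.valuation_of_algebraMap, v.valuation_of_algebraMap,
    v.valuation_of_algebraMap, intValuation_smul_of_inertia v hinert,
    intValuation_smul_of_inertia v hinert]

/-- An element whose norm is a unit is a `P`-adic unit at a totally ramified prime `P`:
`v_P(N x) = [L:F] · v_P(x)`. [folklore] -/
theorem valuation_eq_one_of_norm_eq_unit [FiniteDimensional F L] [IsGalois F L] (v : HeightOneSpectrum (𝓞 L))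
    (hinert : ∀ (σ : L ≃ₐ[F] L) (x : 𝓞 L), σ • x - x ∈ v.asIdeal) {x : L} {u : 𝓞 L}
    (hu : IsUnit u) (hx : algebraMap F L (Algebra.norm F x) = u) : v.valuation L x = 1 := by
  have hprod : (v.valuation L x) ^ Fintype.card (L ≃ₐ[F] L) = 1 := by
    have h1 : v.valuation L (algebraMap F L (Algebra.norm F x)) = 1 := by
      rw [hx, show ((u : 𝓞 L) : L) = algebraMap (𝓞 L) L u from rfl, v.valuation_of_algebraMap,
        v.intValuation_eq_one_iff_mem_primeCompl]
      exact fun h => v.isPrime.ne_top (Ideal.eq_top_of_isUnit_mem _ h hu)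
    rw [Algebra.norm_eq_prod_automorphisms, map_prod] at h1
    simp_rw [valuation_smul_of_inertia v hinert] at h1
    rwa [Finset.prod_const, Finset.card_univ] at h1
  have hn : Fintype.card (L ≃ₐ[F] L) ≠ 0 := Fintype.card_ne_zero
  rcases lt_trichotomy (v.valuation L x) 1 with h | h | h
  · exact absurd hprod (pow_lt_one₀ zero_le h hn).ne
  · exact h
  · exact absurd hprod (one_lt_pow₀ h hn).ne'

/-- **`ζ₃` is not a norm from a cyclic cubic extension in which a prime `p ≡ 2, 5 (mod 9)` is
totally ramified.**  Let `L/F` be Galois of degree `3`, `ζ ∈ 𝓞 F` a primitive cube root of unity,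
and `P` a prime of `L` above the rational prime `p ≡ 2, 5 (mod 9)` with residue field of order
`p` or `p²` at which `Gal(L/F)` acts trivially modulo `P` (total ramification).  Then no `x ∈ L`
has `N_{L/F}(x) = ζ`: `x` is a `P`-unit (`v_P ∘ N = 3 v_P`), `N(x) ≡ x³ (mod P)`, and `ζ` is not
a cube in `𝓞 L ⁄ P` (`pow_three_ne_of_orderOf_eq_three`).  This is the local obstruction behind
"`ζ₃ ∈ N(k^×)` only if all `ℓ ∣ f` are `3` or `≡ ±1 (mod 9)`" in Honda's criterion,
[AouissiMayerIsmailiTalbiAzizi2020, proof of Thm. 2.3]. [folklore] -/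
theorem norm_ne_of_inertia_eq_top [FiniteDimensional F L] [IsGalois F L] (h3 : Module.finrank F L = 3) {ζ : 𝓞 F}
    (hζ : ζ ^ 2 + ζ + 1 = 0) {p f : ℕ} (hp9 : p % 9 = 2 ∨ p % 9 = 5) (hf : f = 1 ∨ f = 2)
    (v : HeightOneSpectrum (𝓞 L)) (hpv : (p : 𝓞 L) ∈ v.asIdeal)
    (hcard : Nat.card (𝓞 L ⧸ v.asIdeal) = p ^ f)
    (hinert : ∀ (σ : L ≃ₐ[F] L) (x : 𝓞 L), σ • x - x ∈ v.asIdeal) (x : L) :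
    Algebra.norm F x ≠ (ζ : F) := by
  classical
  intro hx
  let ζL : 𝓞 L := algebraMap (𝓞 F) (𝓞 L) ζ
  have hζL : ζL ^ 2 + ζL + 1 = 0 := by
    have h := congrArg (algebraMap (𝓞 F) (𝓞 L)) hζ
    rwa [map_add, map_add, map_pow, map_one, map_zero] at h
  have hζLu : IsUnit ζL :=
    isUnit_iff_exists_inv.mpr ⟨-ζL - 1, by linear_combination (-1 : 𝓞 L) * hζL⟩
  have hcoeζ : algebraMap F L (ζ : F) = ((ζL : 𝓞 L) : L) :=
    (IsScalarTower.algebraMap_apply (𝓞 F) F L ζ).symm.trans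
      (IsScalarTower.algebraMap_apply (𝓞 F) (𝓞 L) L ζ)
  -- `x` is a `P`-unit, so `x = n / d` with `d ∉ P`
  have hv1 : v.valuation L x = 1 :=
    valuation_eq_one_of_norm_eq_unit v hinert hζLu (by rw [hx, hcoeζ])
  obtain ⟨n, d, hnd⟩ := v.exists_primeCompl_mul_eq_of_integer x hv1.le
  -- norms: `ζ · N(d) = N(n)`, written in `𝓞 L` as products of conjugates
  have hN : algebraMap F L (ζ : F) * algebraMap F L (Algebra.norm F (algebraMap (𝓞 L) L d)) =
      algebraMap F L (Algebra.norm F (algebraMap (𝓞 L) L n)) := by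
    rw [← map_mul, ← hx, ← map_mul, hnd]
  rw [Algebra.norm_eq_prod_automorphisms, Algebra.norm_eq_prod_automorphisms, hcoeζ] at hN
  have hN' : ζL * ∏ σ : L ≃ₐ[F] L, σ • (d : 𝓞 L) = ∏ σ : L ≃ₐ[F] L, σ • n := by
    apply FaithfulSMul.algebraMap_injective (𝓞 L) L
    rw [map_mul, map_prod, map_prod]
    exact hN
  -- reduce modulo `P`: every `σ` acts trivially
  have hmk : ∀ (σ : L ≃ₐ[F] L) (r : 𝓞 L),
      Ideal.Quotient.mk v.asIdeal (σ • r) = Ideal.Quotient.mk v.asIdeal r :=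
    fun σ r => Ideal.Quotient.eq.mpr (hinert σ r)
  have hG : Fintype.card (L ≃ₐ[F] L) = 3 := by
    rw [Fintype.card_eq_nat_card, IsGalois.card_aut_eq_finrank, h3]
  have hq := congrArg (Ideal.Quotient.mk v.asIdeal) hN'
  simp only [map_mul, map_prod, hmk, Finset.prod_const, Finset.card_univ, hG] at hq
  -- in the residue field `𝓞 L ⧸ P` of order `p^f`, `ζ = (n/d)³`: impossible
  haveI : Finite (𝓞 L ⧸ v.asIdeal) := Nat.finite_of_card_ne_zero (by
    rw [hcard]; exact pow_ne_zero _ (by omega))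
  letI : Fintype (𝓞 L ⧸ v.asIdeal) := Fintype.ofFinite _
  letI : Field (𝓞 L ⧸ v.asIdeal) := Ideal.Quotient.field v.asIdeal
  have hd : Ideal.Quotient.mk v.asIdeal (d : 𝓞 L) ≠ 0 := by
    rw [Ne, Ideal.Quotient.eq_zero_iff_mem]
    exact d.2
  have hF : Fintype.card (𝓞 L ⧸ v.asIdeal) = p ^ f := by rw [← Nat.card_eq_fintype_card, hcard]
  have hp3 : Nat.Coprime p 3 :=
    (Nat.Prime.coprime_iff_not_dvd Nat.prime_three).mpr (by omega) |>.symm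
  have hω : orderOf (Ideal.Quotient.mk v.asIdeal ζL) = 3 := orderOf_mk_eq_three hζL _ hpv hp3
  refine pow_three_ne_of_orderOf_eq_three hF hf hp9 hω
    (Ideal.Quotient.mk v.asIdeal n * (Ideal.Quotient.mk v.asIdeal (d : 𝓞 L))⁻¹) ?_
  rw [mul_pow, ← hq, inv_pow, mul_inv_cancel_right₀ (pow_ne_zero 3 hd)]

end TotallyRamifiedNorm


/-! ### The local shape at `p` in `k/k₀`: total ramification, residue field, and `ζ₃ ∉ N(k^×)` -/

section LocalShape

variable {L : Type*} [Field L] [NumberField L]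

/-- `3 ∣ e(v | p)` for every prime `v ∋ p` of a number field containing `∛(pq)` (`p ≠ q` primes):
`3 v(∛(pq)) = v(p) + v(q) = e(v|p)`.  (Degree-free core of `ramificationIdx_eq_three`.) [folklore] -/
theorem three_dvd_ramificationIdx {p q : ℕ} (hp : p.Prime) (hq : q.Prime) (hpq : p ≠ q)
    {α : L} (hα : α ^ 3 = ((p * q : ℕ) : L))
    (v : HeightOneSpectrum (𝓞 L)) (hv : (p : 𝓞 L) ∈ v.asIdeal) :
    3 ∣ v.asIdeal.ramificationIdx ℤ := by
  classical
  haveI := v.isMaximal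
  obtain ⟨θ, hθ⟩ := exists_ringOfIntegers_coe_eq hα
  have hθ3 : θ ^ 3 = (p : 𝓞 L) * (q : 𝓞 L) := by
    apply RingOfIntegers.coe_injective
    have h := hα
    rw [← hθ] at h
    push_cast at h ⊢
    exact_mod_cast h
  set P : Ideal ℤ := Ideal.span {(p : ℤ)} with hPdef
  have hunder : v.asIdeal.under ℤ = P := under_int_eq_span hp v hv
  haveI : v.asIdeal.LiesOver P := ⟨hunder.symm⟩
  haveI : P.IsMaximal := hunder ▸ Ideal.IsMaximal.under ℤ v.asIdeal
  have hPmap : P.map (algebraMap ℤ (𝓞 L)) = Ideal.span {(p : 𝓞 L)} := by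
    rw [hPdef, Ideal.map_span, Set.image_singleton, map_natCast]
  have hp0 : (p : 𝓞 L) ≠ 0 := by exact_mod_cast hp.ne_zero
  have hq0 : (q : 𝓞 L) ≠ 0 := by exact_mod_cast hq.ne_zero
  have hPmap0 : P.map (algebraMap ℤ (𝓞 L)) ≠ ⊥ := by
    rw [hPmap, Ne, Ideal.span_singleton_eq_bot]
    exact hp0
  have he : v.asIdeal.ramificationIdx ℤ = multiplicity v.asIdeal (Ideal.span {(p : 𝓞 L)}) := by
    rw [Ideal.IsDedekindDomain.ramificationIdx_eq_multiplicity P v.asIdeal hPmap0, hPmap]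
  have hvp : v.intValuation (p : 𝓞 L) = WithZero.exp (-(v.asIdeal.ramificationIdx ℤ : ℤ)) := by
    rw [he]
    exact v.intValuation_eq_exp_neg_multiplicity hp0
  have hvq : v.intValuation (q : 𝓞 L) = 1 :=
    HeightOneSpectrum.intValuation_eq_one_iff.mpr (natCast_notMem_of_mem hp hq hpq v hv)
  have hθ0 : θ ≠ 0 := by
    rintro rfl
    rw [zero_pow (by norm_num)] at hθ3
    exact mul_ne_zero hp0 hq0 hθ3.symm
  have hvθ := v.intValuation_eq_exp_neg_multiplicity hθ0
  set m : ℕ := multiplicity v.asIdeal (Ideal.span {θ}) with hmdef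
  have hval : WithZero.exp (-(m : ℤ)) ^ 3 =
      WithZero.exp (-(v.asIdeal.ramificationIdx ℤ : ℤ)) := by
    rw [← hvθ, ← map_pow, hθ3, map_mul, hvp, hvq, mul_one]
  rw [← WithZero.exp_nsmul, WithZero.exp_inj] at hval
  have h3dvd : (v.asIdeal.ramificationIdx ℤ : ℤ) = 3 * m := by
    rw [nsmul_eq_mul] at hval
    push_cast at hval
    linarith
  exact ⟨m, by exact_mod_cast h3dvd⟩

/-- `e(P|ℤ) · f(P|ℤ) ≤ [L : ℚ]` for a prime `P` of a number field `L`. [folklore] -/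
theorem ramificationIdx_mul_inertiaDeg_le_finrank (P : Ideal (𝓞 L)) [P.IsMaximal] :
    P.ramificationIdx ℤ * P.inertiaDeg ℤ ≤ Module.finrank ℚ L := by
  classical
  have hp0 : P.under ℤ ≠ ⊥ := Ideal.under_ne_bot ℤ (Ideal.IsMaximal.ne_bot_of_isIntegral_int P)
  haveI : (P.under ℤ).IsMaximal := Ideal.IsMaximal.under ℤ P
  have hP : P ∈ IsDedekindDomain.primesOverFinset (P.under ℤ) (𝓞 L) :=
    (IsDedekindDomain.mem_primesOverFinset_iff hp0 _).mpr ⟨inferInstance, inferInstance⟩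
  rw [← Ideal.ramificationIdx'_eq_ramificationIdx (P.under ℤ) P hp0,
    ← Ideal.inertiaDeg'_eq_inertiaDeg (P.under ℤ) P,
    ← Ideal.sum_ramification_inertia (𝓞 L) ℚ L hp0, ← Finset.add_sum_erase _ _ hP]
  exact Nat.le_add_right _ _

/-- The residue field at a prime `v ∋ p` of a number field of degree `< 9` containing `∛(pq)` has
order `p` or `p²` (`3 ∣ e`, `e f ≤ [L:ℚ] < 9`). [folklore] -/
theorem card_quot_eq_of_cubeRoot {p q : ℕ} (hp : p.Prime) (hq : q.Prime) (hpq : p ≠ q)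
    {α : L} (hα : α ^ 3 = ((p * q : ℕ) : L)) (hL : Module.finrank ℚ L < 9)
    (v : HeightOneSpectrum (𝓞 L)) (hv : (p : 𝓞 L) ∈ v.asIdeal) :
    ∃ f : ℕ, (f = 1 ∨ f = 2) ∧ Nat.card (𝓞 L ⧸ v.asIdeal) = p ^ f := by
  classical
  haveI := v.isMaximal
  have hunder : v.asIdeal.under ℤ = Ideal.span {(p : ℤ)} := under_int_eq_span hp v hv
  haveI : v.asIdeal.LiesOver (Ideal.span {(p : ℤ)}) := ⟨hunder.symm⟩
  have hpZ : Prime (p : ℤ) := Nat.prime_iff_prime_int.mp hp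
  refine ⟨v.asIdeal.inertiaDeg ℤ, ?_, ?_⟩
  · have h3 := three_dvd_ramificationIdx hp hq hpq hα v hv
    have hle := ramificationIdx_mul_inertiaDeg_le_finrank v.asIdeal
    have hepos : 0 < v.asIdeal.ramificationIdx ℤ := Ideal.ramificationIdx_pos _ _
    have hfpos : 0 < v.asIdeal.inertiaDeg ℤ := Ideal.inertiaDeg_pos _ _
    obtain ⟨c, hc⟩ := h3
    have hc1 : 1 ≤ c := by
      rcases Nat.eq_zero_or_pos c with rfl | h
      · omega
      · exact h
    have h9 : 3 * c * v.asIdeal.inertiaDeg ℤ < 9 := by rw [← hc]; omega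
    have hf3 : v.asIdeal.inertiaDeg ℤ < 3 := by nlinarith
    omega
  · haveI : (Ideal.span {(p : ℤ)}).IsMaximal := hunder ▸ Ideal.IsMaximal.under ℤ v.asIdeal
    have h := Ideal.absNorm_eq_pow_inertiaDeg v.asIdeal hpZ
    rw [Ideal.absNorm_apply, Submodule.cardQuot_apply, Int.natAbs_natCast,
      Ideal.inertiaDeg'_eq_inertiaDeg] at h
    rw [h]

variable {F : Type*} [Field F] [NumberField F] [Algebra F L]

/-- **Total ramification.**  If `L/F` is Galois of degree `3`, `[F : ℚ] = 2` and `3 ∣ e(P|ℤ)`, then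
`e(P | P ∩ 𝓞 F) = 3`, so the inertia group of `P` is all of `Gal(L/F)`: every `σ` acts
trivially on `𝓞 L ⁄ P`. [folklore] -/
theorem smul_sub_mem_of_three_dvd_ramificationIdx [IsGalois F L] (h3 : Module.finrank F L = 3)
    (hF : Module.finrank ℚ F = 2) (v : HeightOneSpectrum (𝓞 L))
    (h3e : 3 ∣ v.asIdeal.ramificationIdx ℤ) (σ : L ≃ₐ[F] L) (x : 𝓞 L) :
    σ • x - x ∈ v.asIdeal := by
  classical
  haveI := v.isMaximal
  set P := v.asIdeal with hPdef
  haveI : (P.under (𝓞 F)).IsMaximal := Ideal.IsMaximal.under (𝓞 F) P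
  -- `e(P|ℤ) = e(P_F|ℤ) · e(P|𝓞 F)` with `e(P_F|ℤ) ≤ 2` and `e(P|𝓞 F) ∣ 3`
  have ht : P.ramificationIdx ℤ =
      (P.under (𝓞 F)).ramificationIdx ℤ * P.ramificationIdx (𝓞 F) :=
    Ideal.ramificationIdx_tower (R := ℤ) (P.under (𝓞 F)) P
  have hdvd3 : P.ramificationIdx (𝓞 F) ∣ 3 := h3 ▸ ramificationIdx_dvd_finrank P
  have hle2 : (P.under (𝓞 F)).ramificationIdx ℤ ≤ 2 := by
    have hp0 : (P.under (𝓞 F)).under ℤ ≠ ⊥ :=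
      Ideal.under_ne_bot ℤ (Ideal.IsMaximal.ne_bot_of_isIntegral_int _)
    haveI : ((P.under (𝓞 F)).under ℤ).IsMaximal := Ideal.IsMaximal.under ℤ _
    have h := Ideal.ramificationIdx_le_finrank (S := 𝓞 F) ℚ F (P.under (𝓞 F))
      (p := (P.under (𝓞 F)).under ℤ)
    rwa [Ideal.ramificationIdx'_eq_ramificationIdx _ _ hp0, hF] at h
  have hposF : 0 < (P.under (𝓞 F)).ramificationIdx ℤ := Ideal.ramificationIdx_pos _ _
  have he3 : P.ramificationIdx (𝓞 F) = 3 := by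
    rcases (Nat.dvd_prime Nat.prime_three).mp hdvd3 with h1 | h3'
    · exfalso
      rw [ht, h1, mul_one] at h3e
      have := Nat.le_of_dvd hposF h3e
      omega
    · exact h3'
  -- hence `#I(P) = 3 = #Gal(L/F)`, `I(P) = ⊤`
  have hcard : Nat.card (P.inertia (L ≃ₐ[F] L)) = Nat.card (L ≃ₐ[F] L) := by
    rw [card_inertia_eq_ramificationIdx L (L ≃ₐ[F] L) F P, he3, IsGalois.card_aut_eq_finrank, h3]
  have htop : P.inertia (L ≃ₐ[F] L) = ⊤ := Subgroup.eq_top_of_card_eq _ hcard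
  have hσ : σ ∈ P.inertia (L ≃ₐ[F] L) := htop ▸ Subgroup.mem_top σ
  exact hσ x

/-- **Case (A), local half: `ζ₃ ∉ N_{k/k₀}(k^×)`.**  Let `L/F` be Galois of degree `3` with
`[F : ℚ] = 2` and `ζ ∈ 𝓞 F`, `ζ² + ζ + 1 = 0` (so `F = ℚ(ζ₃)` and `L/F` is a cyclic cubic Kummer
extension), and suppose `L ∋ ∛(pq)` for primes `p ≠ q` with `p ≡ 2, 5 (mod 9)`.  Then `ζ` is not
a norm from `L`.  (The prime of `L` above `p` is totally ramified in `L/F` with residue field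
`𝔽_p` or `𝔽_{p²}`, and `norm_ne_of_inertia_eq_top` applies.)  This is the computation behind
"`ζ₃` can be a norm … only if the prime factors of `f` are `3` or `≡ 1, 8 (mod 9)`",
[AouissiMayerIsmailiTalbiAzizi2020, proof of Thm. 2.3; Cor. 2.1 (2)]. [folklore] -/
theorem norm_ne_of_cubeRoot_of_mod_nine [IsGalois F L] (h3 : Module.finrank F L = 3)
    (hF : Module.finrank ℚ F = 2) {ζ : 𝓞 F} (hζ : ζ ^ 2 + ζ + 1 = 0)
    {p q : ℕ} (hp : p.Prime) (hq : q.Prime) (hpq : p ≠ q) (hp9 : p % 9 = 2 ∨ p % 9 = 5)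
    {α : L} (hα : α ^ 3 = ((p * q : ℕ) : L)) (x : L) :
    Algebra.norm F x ≠ (ζ : F) := by
  classical
  -- a prime `v ∋ p` of `𝓞 L`
  haveI hPmax : (Ideal.span {(p : ℤ)}).IsMaximal :=
    Ideal.IsPrime.isMaximal ((Ideal.span_singleton_prime (by exact_mod_cast hp.ne_zero)).mpr
      (Nat.prime_iff_prime_int.mp hp)) (by
        rw [Ne, Ideal.span_singleton_eq_bot]
        exact_mod_cast hp.ne_zero)
  obtain ⟨Q, hQmax, hQover⟩ :=
    Ideal.exists_maximal_ideal_liesOver_of_isIntegral (S := 𝓞 L) (Ideal.span {(p : ℤ)})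
  have hQ0 : Q ≠ ⊥ := Ideal.IsMaximal.ne_bot_of_isIntegral_int Q
  let v : HeightOneSpectrum (𝓞 L) := ⟨Q, hQmax.isPrime, hQ0⟩
  have hv : (p : 𝓞 L) ∈ v.asIdeal := by
    have h : (p : ℤ) ∈ Q.under ℤ := by
      rw [← hQover.over]
      exact Ideal.mem_span_singleton_self _
    rw [Ideal.mem_comap] at h
    simpa using h
  -- the local shape at `v`
  have hL : Module.finrank ℚ L < 9 := by
    rw [← Module.finrank_mul_finrank ℚ F L, hF, h3]
    norm_num
  obtain ⟨f, hf, hcard⟩ := card_quot_eq_of_cubeRoot hp hq hpq hα hL v hv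
  have hinert : ∀ (σ : L ≃ₐ[F] L) (y : 𝓞 L), σ • y - y ∈ v.asIdeal :=
    smul_sub_mem_of_three_dvd_ramificationIdx h3 hF v (three_dvd_ramificationIdx hp hq hpq hα v hv)
  exact norm_ne_of_inertia_eq_top h3 hζ hp9 hf v hv hcard hinert x

end LocalShape


/-! ### The ambient field `M = ℚ(∛(pq), ζ₃)` and the reduction of case (A) -/

section Ambient

/-- The cube roots of unity in a field containing a primitive one `ζ` are `1, ζ, ζ²`. [folklore] -/
theorem eq_or_eq_or_eq_of_pow_three_eq_one {M : Type*} [Field M] {ζ : M}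
    (hζ : ζ ^ 2 + ζ + 1 = 0) {ω : M} (hω : ω ^ 3 = 1) : ω = 1 ∨ ω = ζ ∨ ω = ζ ^ 2 := by
  have h : (ω - 1) * (ω - ζ) * (ω - ζ ^ 2) = 0 := by
    linear_combination (ω - 1) * (ζ - 1 - ω) * hζ + hω
  rcases mul_eq_zero.mp h with h | h
  · rcases mul_eq_zero.mp h with h | h
    · exact Or.inl (sub_eq_zero.mp h)
    · exact Or.inr (Or.inl (sub_eq_zero.mp h))
  · exact Or.inr (Or.inr (sub_eq_zero.mp h))

/-- The roots of `X² + X + 1` in a field containing one root `ζ` are `ζ, ζ²`. [folklore] -/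
theorem eq_or_eq_of_sq_add_self_add_one {M : Type*} [Field M] {ζ : M}
    (hζ : ζ ^ 2 + ζ + 1 = 0) {ω : M} (hω : ω ^ 2 + ω + 1 = 0) : ω = ζ ∨ ω = ζ ^ 2 := by
  have h : (ω - ζ) * (ω - ζ ^ 2) = 0 := by
    linear_combination hω - (ω + 1 - ζ) * hζ
  rcases mul_eq_zero.mp h with h | h
  · exact Or.inl (sub_eq_zero.mp h)
  · exact Or.inr (sub_eq_zero.mp h)

/-- **The ambient field `M = ℚ(∛(pq), ζ₃)`.**  For primes `p ≠ q` there is a Galois number field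
`M` (a splitting field of `(X³ - pq)(X² + X + 1)`) with a cube root `β` of `pq`, the cubic
subfield `K₁ = ℚ(β)` with `[M : K₁] = 2`, the quadratic subfield `F = ℚ(ζ₃)` with `[M : F] = 3`
and `ζ₃ ∈ 𝓞 F`, `ζ₃² + ζ₃ + 1 = 0`; and every cubic number field containing a cube root of `pq`
is `ℚ`-isomorphic to `K₁`.  (`M = k = K(ζ₃)`, `F = k₀` in the notation of
[AouissiMayerIsmailiTalbiAzizi2020, §2.1].) [folklore] -/
theorem exists_ambient {p q : ℕ} (hp : p.Prime) (hq : q.Prime) (hpq : p ≠ q) :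
    ∃ (M : Type) (_ : Field M) (_ : NumberField M) (_ : IsGalois ℚ M) (β : M)
      (F : IntermediateField ℚ M) (ζ : 𝓞 F),
      β ^ 3 = ((p * q : ℕ) : M) ∧ Module.finrank ℚ ℚ⟮β⟯ = 3 ∧ Module.finrank ℚ⟮β⟯ M = 2 ∧
        Module.finrank ℚ F = 2 ∧ Module.finrank F M = 3 ∧ ζ ^ 2 + ζ + 1 = 0 ∧
        (∀ (K : Type) [Field K] [NumberField K], Module.finrank ℚ K = 3 →
          ∀ α : K, α ^ 3 = ((p * q : ℕ) : K) → Nonempty (K ≃ₐ[ℚ] ℚ⟮β⟯)) := by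
  classical
  -- `g = X² + X + 1 = Φ₃`, `f₁ = X³ - pq`
  obtain ⟨g, hgdef⟩ : ∃ g : ℚ[X], g = cyclotomic 3 ℚ := ⟨_, rfl⟩
  have hgmonic : g.Monic := hgdef ▸ cyclotomic.monic 3 ℚ
  have hg0 : g ≠ 0 := hgmonic.ne_zero
  have hgirr : Irreducible g := hgdef ▸ cyclotomic.irreducible_rat (by norm_num)
  have hgdeg : g.natDegree = 2 := by
    rw [hgdef, natDegree_cyclotomic, Nat.totient_prime Nat.prime_three]
  have hgaeval : ∀ {R : Type} [Field R] [Algebra ℚ R] (x : R), aeval x g = x ^ 2 + x + 1 := by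
    intro R _ _ x
    rw [hgdef, cyclotomic_three]
    simp
  obtain ⟨f₁, hf₁def⟩ : ∃ f₁ : ℚ[X], f₁ = X ^ 3 - Polynomial.C ((p * q : ℕ) : ℚ) := ⟨_, rfl⟩
  have hf₁monic : f₁.Monic := hf₁def ▸ monic_X_pow_sub_C _ (by norm_num)
  have hf₁0 : f₁ ≠ 0 := hf₁monic.ne_zero
  have hf₁deg : f₁.natDegree = 3 := by rw [hf₁def, natDegree_X_pow_sub_C]
  -- the ambient Galois number field `M`, a splitting field of `f₁ · g`
  obtain ⟨M, _instF, _instNF, _instG, _instS⟩ :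
      ∃ (M : Type) (_ : Field M) (_ : NumberField M) (_ : IsGalois ℚ M),
        IsSplittingField ℚ M (f₁ * g) := by
    obtain ⟨instA, hS, hFD, hNo⟩ : ∃ inst : Algebra ℚ (f₁ * g).SplittingField,
        @IsSplittingField ℚ (f₁ * g).SplittingField _ _ inst (f₁ * g) ∧
        @FiniteDimensional ℚ (f₁ * g).SplittingField _ _ inst.toModule ∧
        @Normal ℚ (f₁ * g).SplittingField _ _ inst :=
      ⟨_, Polynomial.IsSplittingField.splittingField (f₁ * g),
        IsSplittingField.finiteDimensional _ (f₁ * g), SplittingField.instNormal (f₁ * g)⟩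
    have hinst : instA = DivisionRing.toRatAlgebra := Subsingleton.elim _ _
    subst hinst
    haveI hN : NumberField (f₁ * g).SplittingField :=
      @NumberField.mk _ _ (SplittingField.instCharZero (f₁ * g)) hFD
    haveI hG : IsGalois ℚ (f₁ * g).SplittingField :=
      { to_isSeparable := inferInstance, to_normal := hNo }
    exact ⟨(f₁ * g).SplittingField, inferInstance, hN, hG, hS⟩
  have hsplit : ((f₁ * g).map (algebraMap ℚ M)).Splits := IsSplittingField.splits M (f₁ * g)
  have hmap0 : (f₁ * g).map (algebraMap ℚ M) ≠ 0 := map_ne_zero (mul_ne_zero hf₁0 hg0)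
  have hf₁split : (f₁.map (algebraMap ℚ M)).Splits :=
    hsplit.of_dvd hmap0 (Polynomial.map_dvd _ (dvd_mul_right f₁ g))
  have hgsplit : (g.map (algebraMap ℚ M)).Splits :=
    hsplit.of_dvd hmap0 (Polynomial.map_dvd _ (dvd_mul_left g f₁))
  -- a root `β` of `f₁`, `K₁ = ℚ(β)`
  have hdegf : (f₁.map (algebraMap ℚ M)).degree ≠ 0 := by
    rw [degree_map, degree_eq_natDegree hf₁0, hf₁deg]; norm_num
  obtain ⟨β, hβ⟩ := hf₁split.exists_eval_eq_zero hdegf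
  have hβ3 : β ^ 3 = ((p * q : ℕ) : M) := by
    rw [eval_map_algebraMap, hf₁def] at hβ
    simp only [map_natCast, aeval_sub, map_pow, aeval_X] at hβ
    exact sub_eq_zero.mp hβ
  have hβ0 : β ≠ 0 := by
    rintro rfl
    rw [zero_pow three_ne_zero] at hβ3
    exact (Nat.cast_ne_zero.mpr (Nat.mul_ne_zero hp.ne_zero hq.ne_zero)) hβ3.symm
  set K₁ : IntermediateField ℚ M := ℚ⟮β⟯ with hK₁def
  have hβint : IsIntegral ℚ β := .of_finite ℚ β
  have hminβ : minpoly ℚ β = f₁ := by rw [hf₁def]; exact minpoly_eq (K := M) hp hq hpq hβ3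
  have hK₁3 : Module.finrank ℚ K₁ = 3 := by
    rw [hK₁def, IntermediateField.adjoin.finrank hβint, hminβ, hf₁deg]
  -- a root `ζ` of `g`, `F = ℚ(ζ)`
  have hdegg : (g.map (algebraMap ℚ M)).degree ≠ 0 := by
    rw [degree_map, degree_eq_natDegree hg0, hgdeg]; norm_num
  obtain ⟨ζ, hζ⟩ := hgsplit.exists_eval_eq_zero hdegg
  have hζeq : ζ ^ 2 + ζ + 1 = 0 := by rwa [eval_map_algebraMap, hgaeval] at hζ
  set F : IntermediateField ℚ M := ℚ⟮ζ⟯ with hFdef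
  have hζint : IsIntegral ℚ ζ := .of_finite ℚ ζ
  have hminζ : minpoly ℚ ζ = g := by
    refine (minpoly.eq_of_irreducible_of_monic hgirr ?_ hgmonic).symm
    rw [hgaeval, hζeq]
  have hF2 : Module.finrank ℚ F = 2 := by
    rw [hFdef, IntermediateField.adjoin.finrank hζint, hminζ, hgdeg]
  -- `M = K₁(ζ)`: every root of `f₁ g` lies in `E = K₁(ζ)`
  set E : IntermediateField ℚ M := (IntermediateField.adjoin K₁ {ζ}).restrictScalars ℚ
    with hEdef
  have hβE : β ∈ E := by
    have h := (IntermediateField.adjoin K₁ {ζ}).algebraMap_mem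
      ⟨β, IntermediateField.mem_adjoin_simple_self ℚ β⟩
    exact h
  have hζE : ζ ∈ E := IntermediateField.mem_adjoin_simple_self K₁ ζ
  have hroots : (f₁ * g).rootSet M ⊆ E := by
    intro γ hγ
    rw [mem_rootSet_of_ne (mul_ne_zero hf₁0 hg0), map_mul] at hγ
    rcases mul_eq_zero.mp hγ with h | h
    · -- `γ³ = pq = β³`, so `γ = β ω` with `ω³ = 1`, `ω ∈ {1, ζ, ζ²}`
      have hγ3 : γ ^ 3 = ((p * q : ℕ) : M) := by
        rw [hf₁def] at h
        simp only [map_natCast, aeval_sub, map_pow, aeval_X] at h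
        exact sub_eq_zero.mp h
      have hω : (γ * β⁻¹) ^ 3 = 1 := by
        rw [mul_pow, inv_pow, hγ3, ← hβ3, mul_inv_cancel₀ (pow_ne_zero 3 hβ0)]
      have hγeq : γ = β * (γ * β⁻¹) := by rw [mul_comm γ, ← mul_assoc, mul_inv_cancel₀ hβ0, one_mul]
      rw [hγeq]
      rcases eq_or_eq_or_eq_of_pow_three_eq_one hζeq hω with h1 | h1 | h1 <;> rw [h1]
      · rw [mul_one]; exact hβE
      · exact mul_mem hβE hζE
      · exact mul_mem hβE (pow_mem hζE 2)
    · have hγ2 : γ ^ 2 + γ + 1 = 0 := by rwa [hgaeval] at h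
      rcases eq_or_eq_of_sq_add_self_add_one hζeq hγ2 with h1 | h1 <;> rw [h1]
      · exact hζE
      · exact pow_mem hζE 2
  have hEtop : E = ⊤ := by
    rw [eq_top_iff]
    intro x _
    have hx : x ∈ Algebra.adjoin ℚ ((f₁ * g).rootSet M) := by
      rw [IsSplittingField.adjoin_rootSet M (f₁ * g)]
      trivial
    exact (Algebra.adjoin_le (S := E.toSubalgebra) hroots) hx
  -- degrees: `[E : ℚ] = 3 d` with `d = [K₁(ζ) : K₁] ≤ 2`, and `2 ∣ [M : ℚ]`
  have hζintK : IsIntegral K₁ ζ := .of_finite K₁ ζ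
  have hd : Module.finrank K₁ (IntermediateField.adjoin K₁ {ζ}) ≤ 2 := by
    rw [IntermediateField.adjoin.finrank hζintK]
    have hdvd : minpoly K₁ ζ ∣ g.map (algebraMap ℚ K₁) :=
      minpoly.dvd K₁ ζ (by rw [aeval_map_algebraMap, hgaeval, hζeq])
    have h := natDegree_le_of_dvd hdvd (Polynomial.map_ne_zero hg0)
    rwa [natDegree_map, hgdeg] at h
  have hEfin : Module.finrank ℚ E = 3 * Module.finrank K₁ (IntermediateField.adjoin K₁ {ζ}) := by
    haveI : Module.Free K₁ (IntermediateField.adjoin K₁ {ζ}) := Module.Free.of_divisionRing _ _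
    haveI : Module.Free ℚ K₁ := Module.Free.of_divisionRing ℚ K₁
    change Module.finrank ℚ (IntermediateField.adjoin K₁ {ζ}) = _
    rw [← Module.finrank_mul_finrank ℚ K₁ (IntermediateField.adjoin K₁ {ζ}), hK₁3]
  have hMfin : Module.finrank ℚ M = Module.finrank ℚ E := by
    rw [hEtop, IntermediateField.finrank_top']
  have h2dvd : 2 ∣ Module.finrank ℚ M := by
    haveI : Module.Free F M := Module.Free.of_divisionRing F M
    haveI : Module.Free ℚ F := Module.Free.of_divisionRing ℚ F
    rw [← Module.finrank_mul_finrank ℚ F M, hF2]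
    exact dvd_mul_right 2 _
  have hdpos : 0 < Module.finrank K₁ (IntermediateField.adjoin K₁ {ζ}) := Module.finrank_pos
  have hM6 : Module.finrank ℚ M = 6 := by
    rw [hMfin, hEfin] at h2dvd ⊢
    interval_cases (Module.finrank K₁ (IntermediateField.adjoin K₁ {ζ}))
    · exfalso; omega
    · rfl
  have hK₁M : Module.finrank K₁ M = 2 := by
    haveI : Module.Free K₁ M := Module.Free.of_divisionRing K₁ M
    haveI : Module.Free ℚ K₁ := Module.Free.of_divisionRing ℚ K₁
    have h := Module.finrank_mul_finrank ℚ K₁ M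
    rw [hK₁3, hM6] at h
    omega
  have hFM : Module.finrank F M = 3 := by
    haveI : Module.Free F M := Module.Free.of_divisionRing F M
    haveI : Module.Free ℚ F := Module.Free.of_divisionRing ℚ F
    have h := Module.finrank_mul_finrank ℚ F M
    rw [hF2, hM6] at h
    omega
  -- `ζ ∈ 𝓞 F`
  set ζF : F := ⟨ζ, IntermediateField.mem_adjoin_simple_self ℚ ζ⟩ with hζFdef
  have hζF : ζF ^ 2 + ζF + 1 = 0 := Subtype.ext (by
    rw [hζFdef]; push_cast; exact hζeq)
  have hζFint : IsIntegral ℤ ζF := by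
    refine ⟨cyclotomic 3 ℤ, cyclotomic.monic 3 ℤ, ?_⟩
    rw [← aeval_def, cyclotomic_three]
    simp only [map_add, map_pow, aeval_X, map_one]
    exact hζF
  refine ⟨M, _instF, _instNF, _instG, β, F, ⟨ζF, hζFint⟩, hβ3, hK₁3, hK₁M, hF2, hFM, ?_, ?_⟩
  · apply RingOfIntegers.coe_injective
    push_cast
    exact hζF
  · intro K _ _ h3 α hα
    have hαint : IsIntegral ℚ α := .of_finite ℚ α
    have hminα : minpoly ℚ α = f₁ := by rw [hf₁def]; exact minpoly_eq hp hq hpq hα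
    let e₂ : ℚ⟮α⟯ ≃ₐ[ℚ] K₁ :=
      (IntermediateField.adjoinRootEquivAdjoin ℚ hαint).symm.trans
        ((AdjoinRoot.algEquivOfEq ℚ _ _ (hminα.trans hminβ.symm)).trans
          (IntermediateField.adjoinRootEquivAdjoin ℚ hβint))
    have htop : ℚ⟮α⟯ = ⊤ := adjoin_eq_top hp hq hpq h3 hα
    let e₃ : K ≃ₐ[ℚ] ℚ⟮α⟯ :=
      IntermediateField.topEquiv.symm.trans (IntermediateField.equivOfEq htop.symm)
    exact ⟨e₃.trans e₂⟩

/-- **Case (A) of Honda's criterion — what is reduced to the ambiguous class number formula.**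
Let `p ≡ 2, 5 (mod 9)` and let `K ∋ ∛(pq)` be a cubic number field with `3 ∣ h(K)`.  Then in the
ambient field `M = K(ζ₃) ⊇ F = ℚ(ζ₃)` (`[M : F] = 3`, cyclic): `3 ∣ h(M)` (ascent along
`[M : K] = 2`), so `Gal(M/F)` fixes a class of order `3` — an ambiguous class — while `ζ₃` is
not a norm from `M` (so `(E_F : E_F ∩ N M^×) = 3`).  Chevalley's ambiguous class number formula
`#Cl(M)^{Gal(M/F)} = h(F) e(𝔭) e(𝔮) / ([M:F] (E_F : E_F ∩ N M^×)) = 1·3·3/(3·3) = 1` (not in the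
tree) then yields the contradiction proving `3 ∤ h(K)`,
[AouissiMayerIsmailiTalbiAzizi2020, Thm. 2.3 and Cor. 2.1 (2)]. [folklore] -/
theorem caseA_reduction {p q : ℕ} (hp : p.Prime) (hq : q.Prime) (hpq : p ≠ q)
    (hp9 : p % 9 = 2 ∨ p % 9 = 5) (K : Type) [Field K] [NumberField K]
    (h3 : Module.finrank ℚ K = 3) {α : K} (hα : α ^ 3 = ((p * q : ℕ) : K))
    (hK : 3 ∣ classNumber K) :
    ∃ (M : Type) (_ : Field M) (_ : NumberField M) (_ : IsGalois ℚ M) (β : M)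
      (F : IntermediateField ℚ M) (ζ : 𝓞 F),
      β ^ 3 = ((p * q : ℕ) : M) ∧ Module.finrank ℚ F = 2 ∧ Module.finrank F M = 3 ∧
        ζ ^ 2 + ζ + 1 = 0 ∧
        (∃ c : ClassGroup (𝓞 M), c ≠ 1 ∧ c ^ 3 = 1 ∧ ∀ σ : M ≃ₐ[F] M,
          ClassGroup.mulEquiv (RingOfIntegers.mapRingEquiv σ.toRingEquiv) c = c) ∧
        (∀ x : M, Algebra.norm F x ≠ ((ζ : F) : F)) := by
  haveI : Fact (Nat.Prime 3) := ⟨Nat.prime_three⟩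
  obtain ⟨M, _i1, _i2, _i3, β, F, ζ, hβ3, hK₁3, hK₁M, hF2, hFM, hζ, hiso⟩ :=
    exists_ambient hp hq hpq
  obtain ⟨e⟩ := hiso K h3 α hα
  have h3K₁ : 3 ∣ classNumber ℚ⟮β⟯ := by
    rwa [← classNumber_eq_of_ringEquiv e.toRingEquiv]
  have h3M : 3 ∣ classNumber M :=
    dvd_classNumber_of_dvd_classNumber_of_not_dvd_finrank (K := ℚ⟮β⟯) (L := M) Nat.prime_three
      h3K₁ (by rw [hK₁M]; omega)
  have hG : IsPGroup 3 (M ≃ₐ[F] M) :=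
    IsPGroup.of_card (n := 1) (by rw [IsGalois.card_aut_eq_finrank, hFM, pow_one])
  obtain ⟨c, hc1, hc3, hfix⟩ := exists_fixed_class_of_dvd_classNumber (K := F) (L := M) hG h3M
  exact ⟨M, _i1, _i2, _i3, β, F, ζ, hβ3, hF2, hFM, hζ, ⟨c, hc1, hc3, hfix⟩, fun x =>
    norm_ne_of_cubeRoot_of_mod_nine (F := F) (L := M) hFM hF2 hζ hp hq hpq hp9 hβ3 x⟩

end Ambient


/-! ### The base field `F = ℚ(ζ₃)`: cyclotomic, class number one, totally complex; `e = 3` above `p, q`; unit norms -/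

section BaseField

variable {M : Type*} [Field M] [NumberField M]

/-- A quadratic subfield `F ⊆ M` containing a primitive cube root of unity is `ℚ(ζ₃)`, a `3`rd
cyclotomic extension of `ℚ`. [folklore] -/
theorem isCyclotomicExtension_three (F : IntermediateField ℚ M) (hF : Module.finrank ℚ F = 2)
    {ζ : 𝓞 F} (hζ : ζ ^ 2 + ζ + 1 = 0) : IsCyclotomicExtension {3} ℚ F := by
  set ζM : M := ((ζ : F) : M) with hζMdef
  have hζF : (ζ : F) ^ 2 + (ζ : F) + 1 = 0 := by
    have h := congrArg (algebraMap (𝓞 F) F) hζ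
    rwa [map_add, map_add, map_pow, map_one, map_zero] at h
  have hζM : ζM ^ 2 + ζM + 1 = 0 := by
    have h := congrArg (algebraMap F M) hζF
    rwa [map_add, map_add, map_pow, map_one, map_zero] at h
  have hprim : IsPrimitiveRoot ζM 3 := by
    haveI : NeZero ((3 : ℕ) : M) := ⟨by norm_num⟩
    rw [← isRoot_cyclotomic_iff, cyclotomic_three, IsRoot.def]
    simp only [eval_add, eval_pow, eval_X, eval_one]
    exact hζM
  have hcyc := hprim.intermediateField_adjoin_isCyclotomicExtension ℚ
  have hle : ℚ⟮ζM⟯ ≤ F := by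
    rw [IntermediateField.adjoin_le_iff, Set.singleton_subset_iff]
    exact (ζ : F).2
  have hint : IsIntegral ℚ ζM := .of_finite ℚ ζM
  have hmin : minpoly ℚ ζM = cyclotomic 3 ℚ := by
    refine (minpoly.eq_of_irreducible_of_monic (cyclotomic.irreducible_rat (by norm_num)) ?_
      (cyclotomic.monic 3 ℚ)).symm
    rw [cyclotomic_three]
    simp only [map_add, map_pow, aeval_X, map_one]
    exact hζM
  have heq : ℚ⟮ζM⟯ = F := by
    refine IntermediateField.eq_of_le_of_finrank_eq hle ?_
    rw [IntermediateField.adjoin.finrank hint, hmin, natDegree_cyclotomic,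
      Nat.totient_prime Nat.prime_three, hF]
  rw [← heq]
  exact hcyc

/-- Hence `h(F) = 1` (`ℤ[ζ₃]` is a PID, Mathlib `IsCyclotomicExtension.Rat.three_pid`). [folklore] -/
theorem classNumber_eq_one_of_sq_add_self_add_one (F : IntermediateField ℚ M)
    (hF : Module.finrank ℚ F = 2) {ζ : 𝓞 F} (hζ : ζ ^ 2 + ζ + 1 = 0) :
    classNumber F = 1 := by
  haveI := isCyclotomicExtension_three F hF hζ
  exact (classNumber_eq_one_iff (K := F)).mpr (IsCyclotomicExtension.Rat.three_pid F)

/-- … and `F` is totally complex (no real places ramify anywhere). [folklore] -/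
theorem isTotallyComplex_of_sq_add_self_add_one (F : IntermediateField ℚ M)
    (hF : Module.finrank ℚ F = 2) {ζ : 𝓞 F} (hζ : ζ ^ 2 + ζ + 1 = 0) :
    IsTotallyComplex F := by
  haveI := isCyclotomicExtension_three F hF hζ
  exact IsCyclotomicExtension.Rat.isTotallyComplex (n := 3) F (by norm_num)

section Ramification

variable {F L : Type*} [Field F] [NumberField F] [Field L] [NumberField L] [Algebra F L]

/-- **`e(𝔓 | 𝔭) = 3`**: for `L/F` Galois of degree `3` over a quadratic field `F` and a prime `𝔓`
of `L` with `3 ∣ e(𝔓|ℤ)` (e.g. above `p` when `∛(pq) ∈ L`), `𝔓` is totally ramified over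
`𝔭 = 𝔓 ∩ 𝓞 F`. [folklore] -/
theorem ramificationIdx_eq_three_of_three_dvd [IsGalois F L] (h3 : Module.finrank F L = 3)
    (hF : Module.finrank ℚ F = 2) (P : Ideal (𝓞 L)) [P.IsMaximal]
    (h3e : 3 ∣ P.ramificationIdx ℤ) : P.ramificationIdx (𝓞 F) = 3 := by
  classical
  haveI : (P.under (𝓞 F)).IsMaximal := Ideal.IsMaximal.under (𝓞 F) P
  have ht : P.ramificationIdx ℤ =
      (P.under (𝓞 F)).ramificationIdx ℤ * P.ramificationIdx (𝓞 F) :=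
    Ideal.ramificationIdx_tower (R := ℤ) (P.under (𝓞 F)) P
  have hdvd3 : P.ramificationIdx (𝓞 F) ∣ 3 := h3 ▸ ramificationIdx_dvd_finrank P
  have hle2 : (P.under (𝓞 F)).ramificationIdx ℤ ≤ 2 := by
    have hp0 : (P.under (𝓞 F)).under ℤ ≠ ⊥ :=
      Ideal.under_ne_bot ℤ (Ideal.IsMaximal.ne_bot_of_isIntegral_int _)
    haveI : ((P.under (𝓞 F)).under ℤ).IsMaximal := Ideal.IsMaximal.under ℤ _
    have h := Ideal.ramificationIdx_le_finrank (S := 𝓞 F) ℚ F (P.under (𝓞 F))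
      (p := (P.under (𝓞 F)).under ℤ)
    rwa [Ideal.ramificationIdx'_eq_ramificationIdx _ _ hp0, hF] at h
  have hposF : 0 < (P.under (𝓞 F)).ramificationIdx ℤ := Ideal.ramificationIdx_pos _ _
  rcases (Nat.dvd_prime Nat.prime_three).mp hdvd3 with h1 | h3'
  · exfalso
    rw [ht, h1, mul_one] at h3e
    have := Nat.le_of_dvd hposF h3e
    omega
  · exact h3'

end Ramification

/-- **The unit norms in case (A).**  In the situation of `caseA_reduction` (`[M : F] = 3`,
`F = ℚ(ζ₃)`, `∛(pq) ∈ M`, `p ≡ 2, 5 (mod 9)`), a unit of `𝓞 F` is a norm from `M` iff it is `±1`: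
the units of `𝓞 F` are `±ζ₃^i` (Mathlib `IsCyclotomicExtension.Rat.Three.Units.mem`), `−1 = N(−1)`,
and `±ζ₃^{±1}` are not norms (`norm_ne_of_cubeRoot_of_mod_nine`).  Hence
`(E_F : E_F ∩ N_{M/F} M^×) = 3`. [folklore] -/
theorem exists_norm_eq_unit_iff (F : IntermediateField ℚ M) [IsGalois F M]
    (h3 : Module.finrank F M = 3) (hF : Module.finrank ℚ F = 2) {ζ : 𝓞 F}
    (hζ : ζ ^ 2 + ζ + 1 = 0) {p q : ℕ} (hp : p.Prime) (hq : q.Prime) (hpq : p ≠ q)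
    (hp9 : p % 9 = 2 ∨ p % 9 = 5) {β : M} (hβ : β ^ 3 = ((p * q : ℕ) : M)) (u : (𝓞 F)ˣ) :
    (∃ x : M, Algebra.norm F x = ((u : 𝓞 F) : F)) ↔ (u = 1 ∨ u = -1) := by
  haveI := isCyclotomicExtension_three F hF hζ
  have hζF : (ζ : F) ^ 2 + (ζ : F) + 1 = 0 := by
    have h := congrArg (algebraMap (𝓞 F) F) hζ
    rwa [map_add, map_add, map_pow, map_one, map_zero] at h
  have hprim : IsPrimitiveRoot (ζ : F) 3 := by
    haveI : NeZero ((3 : ℕ) : F) := ⟨by norm_num⟩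
    rw [← isRoot_cyclotomic_iff, cyclotomic_three, IsRoot.def]
    simp only [eval_add, eval_pow, eval_X, eval_one]
    exact hζF
  have htoInt : hprim.toInteger = ζ := rfl
  -- norms of `-x`
  have hneg : ∀ x : M, Algebra.norm F (-x) = -Algebra.norm F x := fun x => by
    rw [← neg_one_mul x, map_mul, show (-1 : M) = algebraMap F M (-1) by simp,
      Algebra.norm_algebraMap, h3]
    ring
  -- `ζ²` is also a primitive cube root of unity
  have hζ2 : (ζ ^ 2) ^ 2 + ζ ^ 2 + 1 = 0 := by
    have hζ3 : ζ ^ 3 = 1 := by linear_combination (ζ - 1) * hζ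
    linear_combination hζ + ζ * hζ3
  constructor
  · rintro ⟨x, hx⟩
    have hmem := IsCyclotomicExtension.Rat.Three.Units.mem hprim u
    simp only [List.mem_cons, List.not_mem_nil, or_false] at hmem
    rcases hmem with h | h | h | h | h | h
    · exact Or.inl h
    · exact Or.inr h
    · exfalso
      refine norm_ne_of_cubeRoot_of_mod_nine (F := F) (L := M) h3 hF hζ hp hq hpq hp9 hβ x ?_
      rw [hx, h]
      rfl
    · exfalso
      refine norm_ne_of_cubeRoot_of_mod_nine (F := F) (L := M) h3 hF hζ hp hq hpq hp9 hβ (-x) ?_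
      rw [hneg, hx, h]
      simp [htoInt]
    · exfalso
      refine norm_ne_of_cubeRoot_of_mod_nine (F := F) (L := M) h3 hF hζ2 hp hq hpq hp9 hβ x ?_
      rw [hx, h]
      simp [htoInt]
    · exfalso
      refine norm_ne_of_cubeRoot_of_mod_nine (F := F) (L := M) h3 hF hζ2 hp hq hpq hp9 hβ (-x) ?_
      rw [hneg, hx, h]
      simp [htoInt]
  · rintro (rfl | rfl)
    · exact ⟨1, by simp⟩
    · refine ⟨-1, ?_⟩
      rw [hneg, map_one]
      simp

end BaseField


/-! ### `M/F` is unramified outside `pq`: Hecke's criterion at `λ ∣ 3` (local form) and the tame primes -/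

section Wild

variable {H E : Type*} [Field H] [NumberField H] [Field E] [NumberField E] [Algebra H E]

/-- **Hecke's criterion at `λ ∣ 3`, local form.**  Let `H ⊆ E` be number fields, `λ, u, w ∈ 𝓞_H`
with `λ² = −3` and `u = 1 + λ³ w` (i.e. `u ≡ 1 (mod λ³)`), and `E = H(y)` with `y³ = u`.  Then
every prime `𝔔 ∋ 3` of `E` is unramified over `H`: `z = (y − 1)/λ ∈ 𝓞_E` generates `E/H` and is
a root of the monic `t³ − λt² − t − w`, whose derivative at `z` is `≡ −1 (mod 𝔔)`, while it lies
in the different (Neukirch III (2.4)); so `𝔔 ∤ 𝔇(E/H)`.  (The wild half of the tree's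
`differentIdeal_eq_top_of_cube_root_one_mod_lambda_cubed`, without its global hypothesis
`(u) = 𝔞³`.) [cite: Hecke1981, §39 Thm. 119] -/
theorem isUnramifiedAt_of_one_add_lambda_cubed_of_three_mem {lam u w : 𝓞 H}
    (hlam : lam ^ 2 = -3) (hu : u = 1 + lam ^ 3 * w) {y : E}
    (hy : y ^ 3 = algebraMap (𝓞 H) E u) (hgen : IntermediateField.adjoin H {y} = ⊤)
    (Q : Ideal (𝓞 E)) [hQmax : Q.IsMaximal] (h3Q : (3 : 𝓞 E) ∈ Q) :
    Algebra.IsUnramifiedAt (𝓞 H) Q := by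
  classical
  rw [← not_dvd_differentIdeal_iff]
  intro hdvd
  have hDQ : differentIdeal (𝓞 H) (𝓞 E) ≤ Q := Ideal.dvd_iff_le.mp hdvd
  have hlam0 : lam ≠ 0 := by
    rintro rfl
    norm_num at hlam
  have hlamQ : algebraMap (𝓞 H) (𝓞 E) lam ∈ Q := algebraMap_lam_mem_of_three_mem hlam h3Q
  -- the Artin–Schreier generator `z = (y - 1)/λ`
  set lamE : E := algebraMap (𝓞 H) E lam with hlamE
  have hlamE0 : lamE ≠ 0 := by
    rw [hlamE, IsScalarTower.algebraMap_apply (𝓞 H) H E]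
    exact (_root_.map_ne_zero _).mpr (RingOfIntegers.coe_ne_zero_iff.mpr hlam0)
  have hlamE2 : lamE ^ 2 = -3 := by
    rw [hlamE, ← map_pow, hlam, map_neg, map_ofNat]
  have hyE : y ^ 3 = 1 + lamE ^ 3 * algebraMap (𝓞 H) E w := by
    rw [hy, hu, map_add, map_one, map_mul, map_pow]
  set z : E := (y - 1) / lamE with hzdef
  have hz : z ^ 3 - lamE * z ^ 2 - z - algebraMap (𝓞 H) E w = 0 :=
    artinSchreier_cubic_eq_zero hlamE2 hlamE0 hyE
  have hyz : y = 1 + lamE * z := by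
    rw [hzdef, mul_div_cancel₀ _ hlamE0, add_sub_cancel]
  -- `z` is integral: a root of the monic `g = t³ − λt² − t − w`
  set g : (𝓞 H)[X] := X ^ 3 - (C lam * X ^ 2 + X + C w) with hgdef
  have hgmonic : g.Monic := by
    refine (monic_X_pow 3).sub_of_left (lt_of_le_of_lt (degree_add_le _ _) (max_lt
      (lt_of_le_of_lt (degree_add_le _ _) (max_lt ?_ ?_)) ?_))
    · exact (degree_C_mul_X_pow_le 2 lam).trans_lt (by rw [degree_X_pow]; norm_num)
    · rw [degree_X, degree_X_pow]; norm_num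
    · exact (degree_C_le).trans_lt (by rw [degree_X_pow]; norm_num)
  have hgz : aeval z g = 0 := by
    rw [hgdef]
    simp only [map_sub, map_add, map_mul, aeval_X_pow, aeval_C, aeval_X]
    linear_combination hz
  have hzint : IsIntegral ℤ z := by
    have h1 : IsIntegral (𝓞 H) z := ⟨g, hgmonic, by rwa [← aeval_def]⟩
    exact isIntegral_trans z h1
  set Z : 𝓞 E := ⟨z, hzint⟩ with hZdef
  have hZE : algebraMap (𝓞 E) E Z = z := rfl
  -- `E = H(z)`
  have hyint : IsIntegral H y := by
    refine IsIntegral.of_pow (by norm_num : 0 < 3)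
      ⟨Polynomial.X - Polynomial.C (algebraMap (𝓞 H) H u), monic_X_sub_C _, ?_⟩
    simp [hy, IsScalarTower.algebraMap_apply (𝓞 H) H E]
  have hgen' : Algebra.adjoin H {algebraMap (𝓞 E) E Z} = ⊤ := by
    rw [hZE]
    have h1 : Algebra.adjoin H {y} = ⊤ := by
      rw [← IntermediateField.adjoin_simple_toSubalgebra_of_isAlgebraic hyint.isAlgebraic, hgen,
        IntermediateField.top_toSubalgebra]
    apply top_le_iff.mp
    rw [← h1]
    refine Algebra.adjoin_le (Set.singleton_subset_iff.mpr ?_)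
    have hz_mem : z ∈ Algebra.adjoin H {z} := Algebra.subset_adjoin rfl
    have hlamH : lamE = algebraMap H E (lam : H) := IsScalarTower.algebraMap_apply (𝓞 H) H E lam
    rw [SetLike.mem_coe, hyz, hlamH]
    exact Subalgebra.add_mem _ (Subalgebra.one_mem _)
      (Subalgebra.mul_mem _ (Subalgebra.algebraMap_mem _ _) hz_mem)
  -- `g'(Z) ∈ 𝔇`
  have hD := aeval_derivative_mem_differentIdeal (𝓞 H) H E Z hgen'
  have hZint : IsIntegral (𝓞 H) Z := Algebra.IsIntegral.isIntegral Z
  have hgZ : aeval Z g = 0 := by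
    apply FaithfulSMul.algebraMap_injective (𝓞 E) E
    rw [← aeval_algebraMap_apply, hZE, hgz, map_zero]
  obtain ⟨h, hh⟩ := minpoly.isIntegrallyClosed_dvd hZint hgZ
  have hgD : aeval Z (derivative g) ∈ differentIdeal (𝓞 H) (𝓞 E) := by
    have hder : aeval Z (derivative g) =
        aeval Z (derivative (minpoly (𝓞 H) Z)) * aeval Z h := by
      conv_lhs => rw [hh]
      rw [derivative_mul, map_add, map_mul, map_mul, minpoly.aeval, zero_mul, add_zero]
    rw [hder]
    exact Ideal.mul_mem_right _ _ hD
  -- but `g'(Z) = 3Z² − 2λZ − 1 ≡ −1 (mod Q)`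
  have hval : aeval Z (derivative g) =
      3 * Z ^ 2 - algebraMap (𝓞 H) (𝓞 E) lam * (2 * Z) - 1 := by
    rw [hgdef]
    simp only [derivative_X_pow, derivative_mul, derivative_C, derivative_X, zero_mul, zero_add,
      map_sub, map_add, map_mul, aeval_C, aeval_X_pow, Nat.cast_ofNat, map_one, map_zero, map_ofNat]
    ring
  have hmem : 3 * Z ^ 2 - algebraMap (𝓞 H) (𝓞 E) lam * (2 * Z) - 1 ∈ Q := hval ▸ hDQ hgD
  have hmem' : 3 * Z ^ 2 - algebraMap (𝓞 H) (𝓞 E) lam * (2 * Z) ∈ Q :=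
    Q.sub_mem (Q.mul_mem_right _ h3Q) (Q.mul_mem_right _ hlamQ)
  have hone : (1 : 𝓞 E) ∈ Q := by
    have := Q.sub_mem hmem' hmem
    rwa [sub_sub_cancel] at this
  exact hQmax.ne_top ((Ideal.eq_top_iff_one Q).mpr hone)

end Wild

/-- **Tame ramification of a pure cubic extension is supported on `3a`.**  Let `F ⊆ M` be number
fields, `M = F(β)` with `β³ = a ∈ 𝓞 F`.  A prime `𝔔` of `M` containing neither `3` nor `a` is
unramified over `F`: the different contains `g'(β) h(β) = (T³ − a)'(β) = 3β²` for the minimal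
polynomial `g ∣ T³ − a` of `β` over `𝓞 F` (Mathlib `aeval_derivative_mem_differentIdeal`,
Neukirch III (2.4)), and `3β² ∉ 𝔔`. [folklore] -/
theorem isUnramifiedAt_of_cube_eq {F M : Type*} [Field F] [NumberField F] [Field M]
    [NumberField M] [Algebra F M] {a : 𝓞 F} {β : M} (hβ : β ^ 3 = algebraMap (𝓞 F) M a)
    (hgen : IntermediateField.adjoin F {β} = ⊤) (Q : Ideal (𝓞 M)) [hQ : Q.IsMaximal]
    (h3 : (3 : 𝓞 M) ∉ Q) (ha : algebraMap (𝓞 F) (𝓞 M) a ∉ Q) :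
    Algebra.IsUnramifiedAt (𝓞 F) Q := by
  classical
  -- `β` as an algebraic integer `X`
  have hβint : IsIntegral ℤ β := by
    refine IsIntegral.of_pow (by norm_num : 0 < 3) ?_
    rw [hβ, IsScalarTower.algebraMap_apply (𝓞 F) (𝓞 M) M]
    exact (algebraMap (𝓞 F) (𝓞 M) a).isIntegral_coe
  set X : 𝓞 M := ⟨β, hβint⟩ with hXdef
  have hXM : algebraMap (𝓞 M) M X = β := rfl
  have hX3 : X ^ 3 = algebraMap (𝓞 F) (𝓞 M) a := by
    apply RingOfIntegers.ext
    rw [RingOfIntegers.coe_eq_algebraMap, RingOfIntegers.coe_eq_algebraMap, map_pow, hXM, hβ,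
      IsScalarTower.algebraMap_apply (𝓞 F) (𝓞 M) M]
  -- `M = F(β)` at the subalgebra level
  have hβintF : IsIntegral F β := .of_finite F β
  have hgen' : Algebra.adjoin F {algebraMap (𝓞 M) M X} = ⊤ := by
    rw [hXM, ← IntermediateField.adjoin_simple_toSubalgebra_of_isAlgebraic hβintF.isAlgebraic,
      hgen, IntermediateField.top_toSubalgebra]
  -- `g'(X) ∈ 𝔇` and `g ∣ T³ - a`, so `3 X² ∈ 𝔇`
  have hD := aeval_derivative_mem_differentIdeal (𝓞 F) F M X hgen'
  have hXint : IsIntegral (𝓞 F) X := Algebra.IsIntegral.isIntegral X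
  have haev : aeval X (Polynomial.X ^ 3 - Polynomial.C a : (𝓞 F)[X]) = 0 := by
    rw [map_sub, aeval_X_pow, aeval_C, hX3, sub_self]
  obtain ⟨h, hh⟩ := minpoly.isIntegrallyClosed_dvd hXint haev
  have hder := congr_arg (fun q ↦ aeval X (derivative q)) hh
  simp only [derivative_sub, derivative_X_pow, derivative_C, sub_zero, derivative_mul, map_add,
    map_mul, minpoly.aeval, zero_mul, add_zero, aeval_X_pow, map_natCast] at hder
  have h3X : (3 : 𝓞 M) * X ^ 2 ∈ differentIdeal (𝓞 F) (𝓞 M) := by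
    have h' : ((3 : ℕ) : 𝓞 M) * X ^ (3 - 1) =
        aeval X (derivative (minpoly (𝓞 F) X)) * aeval X h := hder
    rw [show ((3 : ℕ) : 𝓞 M) = 3 by norm_num, show (3 - 1 : ℕ) = 2 by norm_num] at h'
    rw [h']
    exact Ideal.mul_mem_right _ _ hD
  -- if `Q ∣ 𝔇` then `3 X² ∈ Q`, impossible
  rw [← not_dvd_differentIdeal_iff]
  intro hdvd
  have hmem : (3 : 𝓞 M) * X ^ 2 ∈ Q := (Ideal.dvd_iff_le.mp hdvd) h3X
  rcases hQ.isPrime.mem_or_mem hmem with h | h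
  · exact h3 h
  · have hXQ : X ∈ Q := hQ.isPrime.mem_of_pow_mem 2 h
    apply ha
    rw [← hX3]
    exact Q.pow_mem_of_mem hXQ 3 (by norm_num)

variable {M : Type*} [Field M] [NumberField M]

/-- In the ambient field: `M = F(β)` (`[F(β) : F] ∣ 3` and `β ∉ F` since `[ℚ(β) : ℚ] = 3 ∤ 2`).
[folklore] -/
theorem adjoin_eq_top_of_finrank (F : IntermediateField ℚ M) (hF : Module.finrank ℚ F = 2)
    (h3 : Module.finrank F M = 3) {β : M} (hβ : Module.finrank ℚ ℚ⟮β⟯ = 3) :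
    IntermediateField.adjoin F {β} = ⊤ := by
  have hβint : IsIntegral F β := .of_finite F β
  set E := IntermediateField.adjoin F {β} with hEdef
  haveI : Module.Free F E := Module.Free.of_divisionRing F E
  haveI : Module.Free E M := Module.Free.of_divisionRing E M
  have htower := Module.finrank_mul_finrank F E M
  rw [h3] at htower
  have hdvd : Module.finrank F E ∣ 3 := ⟨_, htower.symm⟩
  rcases (Nat.dvd_prime Nat.prime_three).mp hdvd with h1 | h3'
  · -- `β ∈ F`: then `ℚ(β) ≤ F`, `3 ≤ 2`
    exfalso
    have hbot : E = ⊥ := IntermediateField.finrank_eq_one_iff.mp h1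
    have hβE : β ∈ E := IntermediateField.mem_adjoin_simple_self F β
    rw [hbot, IntermediateField.mem_bot] at hβE
    obtain ⟨x, hx⟩ := hβE
    have hle : ℚ⟮β⟯ ≤ F := by
      rw [IntermediateField.adjoin_le_iff, Set.singleton_subset_iff, ← hx]
      exact x.2
    have hle' := IntermediateField.finrank_le_of_le_right hle
    rw [hβ, hF] at hle'
    omega
  · refine IntermediateField.eq_of_le_of_finrank_eq le_top ?_
    rw [h3', IntermediateField.finrank_top', h3]

/-- `F(−β) = F(β)`. [folklore] -/
theorem adjoin_neg_eq {F E : Type*} [Field F] [Field E] [Algebra F E] (β : E) :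
    IntermediateField.adjoin F {-β} = IntermediateField.adjoin F {β} := by
  apply le_antisymm
  · rw [IntermediateField.adjoin_le_iff, Set.singleton_subset_iff]
    exact neg_mem (IntermediateField.mem_adjoin_simple_self F β)
  · rw [IntermediateField.adjoin_le_iff, Set.singleton_subset_iff]
    have h := neg_mem (IntermediateField.mem_adjoin_simple_self F (-β))
    rwa [neg_neg] at h

/-- **`M/F` is unramified outside `pq`** (for `pq ≡ ±1 (mod 9)`): in the ambient field
(`F = ℚ(ζ₃)`, `[M : F] = 3`, `M = F(β)`, `β³ = pq`), every prime `𝔔 ∌ pq` of `M` is unramified over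
`F` — away from `3` by the tame computation `𝔇 ∋ 3β²` (`isUnramifiedAt_of_cube_eq`), above `3` by
Hecke's criterion with `λ = 2ζ₃ + 1`, `u = ±pq = 1 + λ³(±λt)` (`9 = λ⁴`).  This is the statement
"the conductor of `k/k₀` is `f = pq`" (`3 ∤ f` iff `pq ≡ ±1 (mod 9)`) of
[AouissiMayerIsmailiTalbiAzizi2020, §2.1 eq. (2.1) and Thm. 2.1 (Dedekind's species)]. [folklore] -/
theorem isUnramifiedAt_of_natCast_notMem {M : Type*} [Field M] [NumberField M]
    (F : IntermediateField ℚ M) (hF : Module.finrank ℚ F = 2) (h3 : Module.finrank F M = 3)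
    {ζ : 𝓞 F} (hζ : ζ ^ 2 + ζ + 1 = 0) {p q : ℕ} (h9 : (p * q) % 9 = 1 ∨ (p * q) % 9 = 8)
    {β : M} (hβ : β ^ 3 = ((p * q : ℕ) : M)) (hβdeg : Module.finrank ℚ ℚ⟮β⟯ = 3)
    (Q : Ideal (𝓞 M)) [Q.IsMaximal] (hpq : ((p * q : ℕ) : 𝓞 M) ∉ Q) :
    Algebra.IsUnramifiedAt (𝓞 F) Q := by
  classical
  have hgen : IntermediateField.adjoin F {β} = ⊤ := adjoin_eq_top_of_finrank F hF h3 hβdeg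
  by_cases h3Q : (3 : 𝓞 M) ∈ Q
  · -- above `3`: Hecke's criterion with `λ = 2ζ + 1`
    set lam : 𝓞 F := 2 * ζ + 1 with hlamdef
    have hlam : lam ^ 2 = -3 := by
      rw [hlamdef]; linear_combination (4 : 𝓞 F) * hζ
    have hlam4 : lam ^ 4 = 9 := by
      rw [show (4 : ℕ) = 2 * 2 by norm_num, pow_mul, hlam]; norm_num
    rcases h9 with h9 | h9
    · -- `pq = 1 + 9t`, `u = pq`, `y = β`
      obtain ⟨t, ht⟩ : ∃ t : ℕ, p * q = 9 * t + 1 := ⟨(p * q) / 9, by omega⟩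
      have hu : ((p * q : ℕ) : 𝓞 F) = 1 + lam ^ 3 * (lam * t) := by
        rw [ht]; push_cast
        linear_combination (-(t : 𝓞 F)) * hlam4
      refine isUnramifiedAt_of_one_add_lambda_cubed_of_three_mem hlam hu (y := β) ?_ hgen Q h3Q
      rw [hβ, map_natCast]
    · -- `pq = 9t - 1`, `u = -pq`, `y = -β`
      obtain ⟨t, ht⟩ : ∃ t : ℕ, p * q + 1 = 9 * t := ⟨(p * q + 1) / 9, by omega⟩
      have hu : (-(p * q : ℕ) : 𝓞 F) = 1 + lam ^ 3 * (-(lam * t)) := by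
        have h' : ((p * q : ℕ) : 𝓞 F) = 9 * t - 1 := by
          have := congrArg (fun n : ℕ => (n : 𝓞 F)) ht
          push_cast at this ⊢
          linear_combination this
        rw [h']
        linear_combination (t : 𝓞 F) * hlam4
      refine isUnramifiedAt_of_one_add_lambda_cubed_of_three_mem hlam hu (y := -β) ?_
        ((adjoin_neg_eq β).trans hgen) Q h3Q
      rw [neg_pow, hβ, map_neg, map_natCast]
      norm_num
  · -- away from `3`: the tame computation
    refine isUnramifiedAt_of_cube_eq (a := ((p * q : ℕ) : 𝓞 F)) ?_ hgen Q h3Q ?_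
    · rw [hβ, map_natCast]
    · rwa [map_natCast]

end Honda1971

end Literature.NumberTheory.NumberFields

end
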